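import Literature.MathematicalPhysics.QuantumFieldTheory.Balaban1983to89.B9SectBGStepAtLetters
import Literature.MathematicalPhysics.QuantumFieldTheory.Balaban1983to89.B9Thm34HolderInputGUniform
import Literature.MathematicalPhysics.QuantumFieldTheory.Balaban1983to89.B9Ineq346L2SecondDiffUniform
import Literature.MathematicalPhysics.QuantumFieldTheory.Balaban1983to89.B9Ineq346L2RightDiffGUniform
import Literature.MathematicalPhysics.QuantumFieldTheory.Balaban1983to89.B9SectBGpStepAtLettersL2TwoDiff
import Literature.MathematicalPhysics.QuantumFieldTheory.Balaban1983to89.B9SectBGpStepAtLettersAn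

/-!
# `Balaban1983to89.B9SectBGStepAtLettersMore` — [B9] Sect. B for the bond-sector operator G(U′U), the THREE REMAINING
# positive-input steps at the letters: the input-Hölder blocks (3.44) ∕ (3.45) (`E4H2GFrame`, ★ `stepE4Pos_of_e4h2GFrame`,
# ★ `stepH2Pos_of_e4h2GFrame`) and the two-difference L² members (3.46)₄ (`L2SecondDiffGFrame`,
# ★ `stepL2nPos_three_of_l2SecondDiffGFrame`) and (3.46)₆ (`L2RightDiffGFrame`, ★ `stepL2nPos_five_of_l2RightDiffGFrame`);
# then THE WHOLE SECT.-B LETTERS DICTIONARY `SectBFrame` (all G′ and G frames merged on one set of letters) and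
# ★★ `sectBStepPrinted_of_sectBFrame : SectBFrame … → ModelSignsOn → B9.Thm32Printed → B9.Thm33Printed → B9.SectBStepPrinted …`
# — row 13's `hB` of the N06 record in ONE instantiation

T. Bałaban, *Propagators for lattice gauge theories in a background field*, Commun. Math. Phys. **99** (1985) 389–434
[`Balaban1985BackgroundPropagators`, "B9"]; [4] = T. Bałaban, *Propagators and renormalization transformations for lattice
gauge theories. II*, Commun. Math. Phys. **96** (1984) 223–250 [`Balaban1984PropagatorsII`].

statement-level skeleton of published theorems with citation tags; proofs where landed; nothing here is a claim about the
Yang–Mills mass gap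

THE PRINTED LOCUS (verbatim).  Theorem 3.4, p. 400: *"The extended operators satisfy all the inequalities of Theorems 3.1–3.3
correspondingly."*; Theorem 3.3 p. 399: *"the operator G(U) (a = 1) satisfies the inequalities (3.42)–(3.47), with G′(U)
replaced by G(U) and λ replaced by a function J defined at bonds of the lattice"*; p. 407: *"This way we get all these
inequalities for the operator G(U′U), the local ones follow from the bound (3.85) and Lemma 2.1 [4]"*; (3.44)–(3.46) p. 398.

THE POINT.  `B9SectBGStepAtLetters` (same seat, p480613) wrote the bond-sector letters dictionary `GFrame` ∕ `KerGFrame` ∕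
`L2GFrame` and inhabited the steps 13-E(G), 13-Glob(G), 13-H1(G), 13-L2ₙ(G) (n = 0,1,2,4), 13-An(G) of
`B9SectBStepWhole.sectBStepPrinted_of_posBlockSteps` from r06's uniform theorems.  THIS FILE adds, on the same letters, the three
remaining G-side steps: `E4H2GFrame extends KerGFrame` by the single per-input ∕ per-probe transfer field `e4h2G_transfer` (the
conclusions (v), (vi) of `B9Thm34HolderInputGUniform.thm34_all_holderInput_uniform` verbatim) with ★ `stepE4Pos_of_e4h2GFrame` ∕
★ `stepH2Pos_of_e4h2GFrame`; `L2SecondDiffGFrame extends L2GFrame` by the reading `read46_4G` ((3.46)₄ of `GA` at U as r06's L²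
block input) and the writing `writeL2_4G` with ★ `stepL2nPos_three_of_l2SecondDiffGFrame` from
`B9Ineq346L2SecondDiffUniform.thm34_G_l2_second_uniform`; `L2RightDiffGFrame extends L2GFrame` by the second kernel-form law `kerGp`
(Theorem 3.1 for G′(U) in the bond-sector pairing), the second-stencil (3.35) law `reg335'`, the COLUMN-bound laws of the
letters Q, Q*, a, F₂, F₂* (transposes of their majorants), the reading `read46_6G` and the writing `writeL2_6G`, with
★ `stepL2nPos_five_of_l2RightDiffGFrame` from `B9Ineq346L2RightDiffGUniform.thm34_G_l2_right_uniform`.  Each proof = the r06 uniform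
theorem at a common (constant, rate) pair with all inputs lowered to it, `thm34_Gp_uniform` for the G′ identities, the three
uniqueness identifications of `B9SectBGStepAtLetters.entries342_ext_of_gFrame` (`gop_eq`, `cop_eq`, the section identity
`rZero_add_pPrime_sections` + `coord_mul`, `gb_eq`), then the frame's writing ∕ transfer field.  With this file ALL 24
positive-input steps of row 13 are framed at r06's letters (G′ side: `B9SectBGpStepAtLetters*`; G side: `B9SectBGStepAtLetters*`),
the L² ∕ Hölder ones modulo the displayed kernel-form laws `ker31` ∕ `kerG` ∕ `kerGp` (ROW 13′: Theorems 3.1 ∕ 3.3 in kernel form,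
N06 content) — and the last section BUNDLES them: `SectBFrame` extends every frame of both sides (Lean merges the shared
`GpFrame` ∕ `CinvFrame` ∕ `GFrame` ∕ `KerGFrame` ∕ `L2GFrame` ∕ `L2Frame` fields), and ★★ `sectBStepPrinted_of_sectBFrame` feeds
`B9SectBStepWhole.sectBStepPrinted_of_posBlockSteps` with the fourteen block-steps (the six L² members per family assembled by
`stepL2nPos_gp_of_sectBFrame` ∕ `stepL2nPos_g_of_sectBFrame` + `stepL2Pos_of_members`; the analytic step by
`stepAnalyticPos_of_halves`): `hB` = ONE instantiation of `SectBFrame` + the model signs + Theorems 3.2 ∕ 3.3 of the leaf.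

HONEST SCOPE.  Nothing of print is asserted and no operator of [B9] is constructed: the three frames are hypothesis structures,
r06's theorems are USED BY NAME, the proofs are quantifier bookkeeping + uniqueness of two-sided inverses + the section identity.
The frames are not shown inhabited (inhabitant = the operator layer of record, NODE 00 def-Y's bond sector — not in the tree);
count-neutral; NOT a node discharge; nothing continuum, nothing about the mass gap.  Cell `pub-ymgap` (HUMAN RULING D-0062), Track
A node N06 [B9], N06-ASSIGNMENT row 13 (steps 13-E4(G), 13-H2(G), 13-L2₃(G), 13-L2₅(G) and the whole-row capstone), seat
`pub-ymgap-dag-n06-c` (g3), 2026-08-27.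
-/

noncomputable section

namespace Literature.MathematicalPhysics.QuantumFieldTheory.Balaban1983to89.B9SectBGStepAtLettersMore

open Literature.MathematicalPhysics.QuantumFieldTheory.Balaban1983to89
open Literature.MathematicalPhysics.QuantumFieldTheory.Balaban1983to89.B6RandomWalk (HasMajorant hasMajorant_mono Triangle254 Ineq261)
open Literature.MathematicalPhysics.QuantumFieldTheory.Balaban1983to89.B6RandomWalkHom (HasMajorantHom)
open Literature.MathematicalPhysics.QuantumFieldTheory.Balaban1983to89.B6RandomWalkSection (secExt secRes secConj secConj_def
  secRes_comp_secExt)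
open Literature.MathematicalPhysics.QuantumFieldTheory.Balaban1983to89.B9Thm34Ext (toB6)
open Literature.MathematicalPhysics.QuantumFieldTheory.Balaban1983to89.B9Ineq347 (ScaleTransfer)
open Literature.MathematicalPhysics.QuantumFieldTheory.Balaban1983to89.B9Eq39Adjoint (covD covDstar prodCfg plaqU)
open Literature.MathematicalPhysics.QuantumFieldTheory.Balaban1983to89.B9Eq369Small (Through)
open Literature.MathematicalPhysics.QuantumFieldTheory.Balaban1983to89.B9Eq372Locality (stBonds)
open Literature.MathematicalPhysics.QuantumFieldTheory.Balaban1983to89.B9Eq352DivForm (tauF tauB)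
open Literature.MathematicalPhysics.QuantumFieldTheory.Balaban1983to89.B9Eq352DivFormLetters (conj)
open Literature.MathematicalPhysics.QuantumFieldTheory.Balaban1983to89.B9Eq352GradLetters (diffLetter)
open Literature.MathematicalPhysics.QuantumFieldTheory.Balaban1983to89.B9Eq371GradLetters (bT bU)
open Literature.MathematicalPhysics.QuantumFieldTheory.Balaban1983to89.B9Eq372RemLetters (lapDDLetter)
open Literature.MathematicalPhysics.QuantumFieldTheory.Balaban1983to89.B9Eq382V3Letters (dPrimeLetter)
open Literature.MathematicalPhysics.QuantumFieldTheory.Balaban1983to89.B9Eq376POneLetters (conjHom gradLin divLin)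
open Literature.MathematicalPhysics.QuantumFieldTheory.Balaban1983to89.B9Eq386Neumann (pTwo deltaA)
open Literature.MathematicalPhysics.QuantumFieldTheory.Balaban1983to89.B9Eq360Vprime (gPrimeExtEnd pPrime pOp)
open Literature.MathematicalPhysics.QuantumFieldTheory.Balaban1983to89.B9Eq360VprimeLetters (vPrimeConc)
open Literature.MathematicalPhysics.QuantumFieldTheory.Balaban1983to89.B9Thm34SectBUniform (thm34_Gp_uniform)
open Literature.MathematicalPhysics.QuantumFieldTheory.Balaban1983to89.B9Thm34GUniform (thm34_G_clause_uniform)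
open Literature.MathematicalPhysics.QuantumFieldTheory.Balaban1983to89.B9Ineq346L2Uniform (thm34_G_l2_uniform)
open Literature.MathematicalPhysics.QuantumFieldTheory.Balaban1983to89.B6RandomWalkKernel (HasKernelBound hasKernelBound_mono)
open Literature.MathematicalPhysics.QuantumFieldTheory.Balaban1983to89.B9FromB6 (EBlock)
open Literature.MathematicalPhysics.QuantumFieldTheory.Balaban1983to89.B9SectBStepWhole (StepPos StepEPos)
open Literature.MathematicalPhysics.QuantumFieldTheory.Balaban1983to89.B9SectBGpStepAtLetters (GpFrame CinvFrame)
open Literature.MathematicalPhysics.QuantumFieldTheory.Balaban1983to89.B9SectBGStepAtLetters (GFrame KerGFrame L2GFrame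
  GlobGFrame H1GFrame AnGFrame rZero_add_pPrime_sections stepEPos_of_gFrame stepGlobPos_of_globGFrame stepH1Pos_of_h1GFrame
  stepL2nPos_of_l2GFrame stepAnalyticPos1_of_anGFrame)

universe u

variable {I : Type} (d : ℕ) (c35 : ℝ) (geo : I → B9.Geometry) (bg : I → B9.Backgrounds)
  (Gp : ∀ i, B9.KernelFamily (geo i) (bg i))
  {𝔸 : Type u} [NormedRing 𝔸] [NormedAlgebra ℂ 𝔸] [CompleteSpace 𝔸] {ι : Type} [Fintype ι] [DecidableEq ι]
  (b : Module.Basis ι ℝ 𝔸) (κ : Type) [Fintype κ] [LinearOrder κ]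
  (S : I → Type) [∀ i, Fintype (S i)] [∀ i, DecidableEq (S i)]
  [∀ i, Fintype (geo i).Site] [∀ i, DecidableEq (geo i).Site] [∀ i, Nonempty (geo i).Site]

/-- Rate bookkeeping for block majorants: a majorant `c·P(a)·e^{−δd}` with `c·P ≧ 0` stays one at any smaller rate `δ′ ≦ δ`
(d ≧ 0). [folklore] -/
private theorem hasMajorant_rate_le {g : B6.Geometry} {X : Type} (blk : X → g.Site) {T : Module.End ℝ (X → ℝ)}
    {c δ δ' : ℝ} (P : g.Site → ℝ) (hc : ∀ a, 0 ≤ c * P a) (hδ : δ' ≤ δ) (hd : ∀ a a' : g.Site, 0 ≤ g.dist a a')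
    (h : HasMajorant blk T (fun a a' => c * P a * Real.exp (-(δ * g.dist a a')))) :
    HasMajorant blk T (fun a a' => c * P a * Real.exp (-(δ' * g.dist a a'))) :=
  hasMajorant_mono blk h fun a a' =>
    mul_le_mul_of_nonneg_left (Real.exp_le_exp.2 (by nlinarith [hd a a', hδ])) (hc a)

/-- Profile bookkeeping: `c·p·e^{−δd} ≦ c′·p·e^{−δ′d}` for `c ≦ c′`, `0 ≦ c′`, `δ′ ≦ δ`, `p, d ≧ 0`. [folklore] -/
private theorem prof_le {c c' δ δ' d p : ℝ} (hp : 0 ≤ p) (hc : c ≤ c') (hc' : 0 ≤ c') (hδ : δ' ≤ δ) (hd : 0 ≤ d) :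
    c * p * Real.exp (-(δ * d)) ≤ c' * p * Real.exp (-(δ' * d)) :=
  mul_le_mul (mul_le_mul_of_nonneg_right hc hp) (Real.exp_le_exp.2 (by nlinarith)) (Real.exp_nonneg _) (mul_nonneg hc' hp)

variable {d c35 geo bg Gp b κ S}

/-! ## The input-Hölder blocks (3.44) ∕ (3.45) of G(U′U) at the letters — kernel-form input displayed

r06's `B9Thm34HolderInputGUniform.thm34_all_holderInput_uniform` transfers, PER INPUT (a pair of letters `D_l`, `D_s` with
(3.42)₂ ∕ (3.42)₃-type entries, a block-supported `μ` with bound `M`, the (3.44) datum `N` of the unperturbed G(U)) and PER PROBE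
(`Φ`, anchor, exponent, sizes; the (3.45) datum `N₂`), the (3.44)- and (3.45)-type members from G(U) to G(U′U) (clauses (v),
(vi), rate δ/7); its inputs are those of the G-clause PLUS the kernel form of Theorem 3.3 for G(U) — so the frame below extends
`KerGFrame` by the single transfer field `e4h2G_transfer`, exactly as `B9SectBGpStepAtLetters.E4H2Frame` does for G′. -/

variable (c35 geo bg Gp b κ S) in
/-- **THE LETTERS DICTIONARY FOR THE INPUT-HÖLDER BLOCKS (3.44) ∕ (3.45) OF G** — `KerGFrame` plus ONE transfer field: given the
(3.42) and (3.43)–(3.45) blocks of `GA` at U (rate δ₀), a call rate `0 < δ ≦ δ₀` and call constant `Bc ≧ cRG·B₀`, and r06's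
per-input ∕ per-probe transfers (v) (sup output) and (vi) (Hölder output) for the family's own `G(U′U)` with constant `B` at rate
δ/7, the (3.44) and (3.45) blocks of `GA` hold at U′U with (`wE4G B δ B′₀(·)`, `wHGδ' δ`) and (`wH2G B δ B₀(·) B′₀(·,·)`, `wHGδ' δ`).
Field shapes = the conclusions (v), (vi) of `thm34_all_holderInput_uniform` verbatim.  A hypothesis structure; nothing asserted.
[cite: Balaban1985BackgroundPropagators, (3.44)–(3.45) p.398 + (3.40) p.397 + Thm 3.3 p.399 + p.407; Balaban1984PropagatorsII, (2.51)–(2.52) p.232 + Lemma 2.1 p.234] -/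
structure E4H2GFrame (GA : ∀ i, B9.KernelFamily (geo i) (bg i)) (Cinv : ∀ i, B9.SiteKernel (geo i) (bg i))
    extends KerGFrame c35 geo bg Gp b κ S GA Cinv where
  wE4G : ℝ → ℝ → (ℝ → ℝ) → (ℝ → ℝ)
  wH2G : ℝ → ℝ → (ℝ → ℝ) → (ℝ → ℝ → ℝ) → (ℝ → ℝ → ℝ)
  wHGδ' : ℝ → ℝ
  wHGδ'_pos : ∀ δ : ℝ, 0 < δ → 0 < wHGδ' δ
  /-- THE TRANSFER: r06's per-input (v) and per-probe (vi) input-Hölder transfers for `G(U′U)` ⇒ the (3.44), (3.45) blocks of `GA` at U′U. -/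
  e4h2G_transfer : ∀ i (α₀ : ℝ) (U U' : (bg i).Cfg) (α₁ B₀ Bc B δ₀ δ : ℝ) (Bβ Bε : ℝ → ℝ) (Bεβ : ℝ → ℝ → ℝ),
    MInv ≤ (geo i).M → 0 < α₀ → (geo i).M * α₀ ≤ aInv → (bg i).Reg335 c35 α₀ U →
    0 < α₁ → α₁ ≤ aW → (bg i).Cplx337 α₁ U U' → 0 < B₀ → cRG * B₀ ≤ Bc → 0 ≤ B → 0 < δ → δ ≤ δ₀ →
    EBlock (GA i) B₀ δ₀ U → B9.Ineq343_345 (GA i) Bβ Bε Bεβ δ₀ U →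
    -- (v) the (3.44)-type member, per pair of letters and per input
    (∀ (Dl Ds : Module.End ℝ ((κ × S i) × ι → ℝ)),
      HasMajorant (g := toB6 (geo i) (Rr i) (Hp i)) (fun q : (κ × S i) × ι => blk i q.1.2) (Dl * Gb i U)
        (fun a a' => Bc * (geo i).len a * Real.exp (-(δ * (geo i).dist a a'))) →
      HasMajorant (g := toB6 (geo i) (Rr i) (Hp i)) (fun q : (κ × S i) × ι => blk i q.1.2) (Gb i U * Ds)
        (fun a a' => Bc * (geo i).len a * Real.exp (-(δ * (geo i).dist a a'))) →
      ∀ (y' : (geo i).Site) (μ : (κ × S i) × ι → ℝ) (M : ℝ),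
        B6RandomWalk.BlockSupp (g := toB6 (geo i) (Rr i) (Hp i)) (fun q : (κ × S i) × ι => blk i q.1.2) μ y' M →
      ∀ (N : ℝ), 0 ≤ N →
        (∀ (k : κ ⊕ κ) (z : (κ × S i) × ι),
          |(((conj b (diffLetter (bT (T i)) (bU (coord i U)) ((((geo i).eta : ℂ))⁻¹) k)) * Gb i U * Ds) μ) z| ≤
            N * Real.exp (-(δ * (geo i).dist (blk i z.1.2) y'))) →
        (∀ z : (κ × S i) × ι, |((Dl * Gb i U * Ds) μ) z| ≤ N * Real.exp (-(δ * (geo i).dist (blk i z.1.2) y'))) →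
        ∀ x : (κ × S i) × ι, |((Dl * Gb i ((bg i).mul U' U) * Ds) μ) x| ≤
          B * (N + M) * Real.exp (-(δ / 7 * (geo i).dist (blk i x.1.2) y'))) →
    -- (vi) the (3.45)-type member, per pair of letters, per probe and per input
    (∀ (Dl Ds : Module.End ℝ ((κ × S i) × ι → ℝ)),
      HasMajorant (g := toB6 (geo i) (Rr i) (Hp i)) (fun q : (κ × S i) × ι => blk i q.1.2) (Dl * Gb i U)
        (fun a a' => Bc * (geo i).len a * Real.exp (-(δ * (geo i).dist a a'))) →
      HasMajorant (g := toB6 (geo i) (Rr i) (Hp i)) (fun q : (κ × S i) × ι => blk i q.1.2) (Gb i U * Ds)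
        (fun a a' => Bc * (geo i).len a * Real.exp (-(δ * (geo i).dist a a'))) →
      ∀ (Φ : (κ × S i → 𝔸) →ₗ[ℝ] 𝔸) (y : (geo i).Site) (p₀ : (κ × S i) × ι), blk i p₀.1.2 = y →
      ∀ (γ Bh cζ : ℝ), 0 ≤ Bh → 0 ≤ cζ →
        (∀ (y'' : (geo i).Site) (ν : (κ × S i) × ι → ℝ) (C : ℝ),
          B6RandomWalk.BlockSupp (g := toB6 (geo i) (Rr i) (Hp i)) (fun q : (κ × S i) × ι => blk i q.1.2) ν y'' C →
          ‖Φ ((B9Eq352DivFormLetters.coordEquiv b).symm (Dl (Gb i U ν)))‖ ≤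
            Bh * (geo i).len y ^ (1 - γ) * cζ * Real.exp (-(δ * (geo i).dist y y'')) * C) →
      ∀ (y' : (geo i).Site) (μ : (κ × S i) × ι → ℝ) (M : ℝ),
        B6RandomWalk.BlockSupp (g := toB6 (geo i) (Rr i) (Hp i)) (fun q : (κ × S i) × ι => blk i q.1.2) μ y' M →
      ∀ (N : ℝ), 0 ≤ N →
        (∀ (k : κ ⊕ κ) (z : (κ × S i) × ι),
          |(((conj b (diffLetter (bT (T i)) (bU (coord i U)) ((((geo i).eta : ℂ))⁻¹) k)) * Gb i U * Ds) μ) z| ≤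
            N * Real.exp (-(δ * (geo i).dist (blk i z.1.2) y'))) →
      ∀ (N₂ : ℝ), 0 ≤ N₂ →
        ‖Φ ((B9Eq352DivFormLetters.coordEquiv b).symm ((Dl * Gb i U * Ds) μ))‖ ≤ N₂ * Real.exp (-(δ * (geo i).dist y y')) →
        ‖Φ ((B9Eq352DivFormLetters.coordEquiv b).symm ((Dl * Gb i ((bg i).mul U' U) * Ds) μ))‖ ≤
          B * (N₂ + Bh * (geo i).len y ^ (1 - γ) * cζ * ((geo i).len y)⁻¹ * (N + M)) *
            Real.exp (-(δ / 7 * (geo i).dist y y'))) →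
    B9FromB6.E4Block (GA i) (wE4G B δ Bε) (wHGδ' δ) ((bg i).mul U' U) ∧
      B9FromB6.H2Block (GA i) (wH2G B δ Bβ Bεβ) (wHGδ' δ) ((bg i).mul U' U)

/-- The two input-Hölder blocks of G(U′U) at the letters, in one positive-input step (product of outputs): r06's
`thm34_all_holderInput_uniform` at the common pair `(max(cRG·B₀, B_KG), δr)`, `thm34_Gp_uniform` for the G′ identities, the
three uniqueness identifications, then `e4h2G_transfer`. [cite: Balaban1985BackgroundPropagators, Thm 3.4 p.400 + (3.44)–(3.45) p.398 + Thm 3.3 p.399 + p.407] -/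
theorem stepE4H2GPos_of_e4h2GFrame {GA : ∀ i, B9.KernelFamily (geo i) (bg i)} {Cinv : ∀ i, B9.SiteKernel (geo i) (bg i)}
    (F : E4H2GFrame c35 geo bg Gp b κ S GA Cinv) :
    StepPos F.dB c35 geo bg Gp GA Cinv (((ℝ → ℝ) × ℝ) × ((ℝ → ℝ → ℝ) × ℝ)) (fun c => 0 < c.1.2 ∧ 0 < c.2.2)
      (fun c i U α₁ => ∀ U' : (bg i).Cfg, (bg i).Cplx337 α₁ U U' →
        B9FromB6.E4Block (GA i) c.1.1 c.1.2 ((bg i).mul U' U) ∧ B9FromB6.H2Block (GA i) c.2.1 c.2.2 ((bg i).mul U' U)) := by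
  classical
  intro B₀ δ₀ Bβ Bε Bεβ B₁ δ₁ hB₀ hδ₀ hB₁ hδ₁
  have hδr : 0 < min (min δ₀ δ₁) (min F.δcap F.δKG) := lt_min (lt_min hδ₀ hδ₁) (lt_min F.δcap_pos F.δKG_pos)
  have hδr0 : min (min δ₀ δ₁) (min F.δcap F.δKG) ≤ δ₀ := le_trans (min_le_left _ _) (min_le_left _ _)
  have hδr1 : min (min δ₀ δ₁) (min F.δcap F.δKG) ≤ δ₁ := le_trans (min_le_left _ _) (min_le_right _ _)
  have hδrc : min (min δ₀ δ₁) (min F.δcap F.δKG) ≤ F.δcap := le_trans (min_le_right _ _) (min_le_left _ _)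
  have hδrK : min (min δ₀ δ₁) (min F.δcap F.δKG) ≤ F.δKG := le_trans (min_le_right _ _) (min_le_right _ _)
  have hBG : 0 < F.cR * B₀ := mul_pos F.cR_pos hB₀
  have hBb : 0 < F.cRG * B₀ := mul_pos F.cRG_pos hB₀
  have hBc : 0 < max (F.cRG * B₀) F.BKG := lt_max_of_lt_left hBb
  have hBK : 0 < F.cK * B₁ := mul_pos F.cK_pos hB₁
  have hcle : F.cRG * B₀ ≤ max (F.cRG * B₀) F.BKG := le_max_left _ _
  have hKle : F.BKG ≤ max (F.cRG * B₀) F.BKG := le_max_right _ _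
  obtain ⟨a₁, ha₁, B', -, H'⟩ := thm34_Gp_uniform b κ F.dB (min (min δ₀ δ₁) (min F.δcap F.δKG)) (F.cR * B₀) F.Cq F.a₀ F.d₀
    F.M₂ (F.Λf (min (min δ₀ δ₁) (min F.δcap F.δKG))) hBG F.Cq_nonneg F.a₀_nonneg F.M₂_nonneg hδr
    (fun α hα => F.Λf_one_le _ α hδr hα) F.hrepr
  obtain ⟨a₂, ha₂, B, hB, H⟩ := B9Thm34HolderInputGUniform.thm34_all_holderInput_uniform b κ F.dB
    (min (min δ₀ δ₁) (min F.δcap F.δKG)) (max (F.cRG * B₀) F.BKG) F.κQ (F.cR * B₀) (F.cK * B₁) F.cF F.Cq F.a₀ F.C₀ F.d₀ F.M₂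
    F.κQb F.cFb F.abar (F.Λf (min (min δ₀ δ₁) (min F.δcap F.δKG))) hBc.le F.κQ_pos hBG hBK F.cF_pos F.Cq_nonneg F.a₀_nonneg
    F.C₀_nonneg F.M₂_nonneg hδr F.κQb_nonneg F.cFb_nonneg F.abar_nonneg (fun α hα => F.Λf_one_le _ α hδr hα) hBc F.hrepr
  refine ⟨F.MInv, min (min a₁ a₂) F.aW, F.aInv,
    ((F.wE4G B (min (min δ₀ δ₁) (min F.δcap F.δKG)) Bε, F.wHGδ' (min (min δ₀ δ₁) (min F.δcap F.δKG))),
      (F.wH2G B (min (min δ₀ δ₁) (min F.δcap F.δKG)) Bβ Bεβ, F.wHGδ' (min (min δ₀ δ₁) (min F.δcap F.δKG)))),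
    F.MInv_pos, lt_min (lt_min ha₁ ha₂) F.aW_pos, F.aInv_pos, ⟨F.wHGδ'_pos _ hδr, F.wHGδ'_pos _ hδr⟩, ?_⟩
  intro i hM α₀ hα₀ hMa U hU hT α₁ hα₁ ha U' hU'
  have ha1 : α₁ ≤ a₁ := le_trans ha (le_trans (min_le_left _ _) (min_le_left _ _))
  have ha2 : α₁ ≤ a₂ := le_trans ha (le_trans (min_le_left _ _) (min_le_right _ _))
  have haW : α₁ ≤ F.aW := le_trans ha (min_le_right _ _)
  -- the site-sector letters at U
  obtain ⟨hΔG, hGΔ⟩ := F.reg_inv i α₀ U hM hα₀ hMa hU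
  obtain ⟨h1, h2, h3, -⟩ := F.read342 i α₀ U B₀ δ₀ hM hα₀ hMa hU hB₀ hδ₀ hT.1.1.1
  have hc2 : ∀ a : (geo i).Site, 0 ≤ F.cR * B₀ * (geo i).len a ^ 2 := fun a => mul_nonneg hBG.le (sq_nonneg _)
  have hc1 : ∀ a : (geo i).Site, 0 ≤ F.cR * B₀ * (geo i).len a := fun a => mul_nonneg hBG.le (F.len_pos i a).le
  have h1' := hasMajorant_rate_le (g := toB6 (geo i) (F.Rr i) (F.Hp i)) (fun p : S i × ι => F.blk i p.1)
    (fun a => (geo i).len a ^ 2) hc2 hδr0 (F.dist_nonneg i) h1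
  have h2' := fun k => hasMajorant_rate_le (g := toB6 (geo i) (F.Rr i) (F.Hp i)) (fun p : S i × ι => F.blk i p.1)
    (fun a => (geo i).len a) hc1 hδr0 (F.dist_nonneg i) (h2 k)
  have h3' := fun k => hasMajorant_rate_le (g := toB6 (geo i) (F.Rr i) (F.Hp i)) (fun p : S i × ι => F.blk i p.1)
    (fun a => (geo i).len a) hc1 hδr0 (F.dist_nonneg i) (h3 k)
  -- the (3.48) kernel of C⁻¹(U) at δ₁ lowered to δr
  have hK := F.readKer i α₀ U B₁ δ₁ hM hα₀ hMa hU hB₁ hδ₁ hT.2.1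
  have hK' : ∀ y y' : (geo i).Site, |B9Thm34Inv.ker (B9Thm34Inv.vol (geo i) F.dB) (F.Cop i U) y y'| ≤
      F.cK * B₁ * (geo i).len y ^ (-(4 : ℝ)) * (geo i).len y' ^ (-(F.dB : ℝ)) *
        Real.exp (-(min (min δ₀ δ₁) (min F.δcap F.δKG) * (geo i).dist y y')) := by
    intro y y'
    refine (hK y y').trans (mul_le_mul_of_nonneg_left (Real.exp_le_exp.2 ?_) ?_)
    · nlinarith [F.dist_nonneg i y y', hδr1]
    · exact mul_nonneg (mul_nonneg hBK.le (Real.rpow_nonneg (F.len_pos i y).le _))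
        (Real.rpow_nonneg (F.len_pos i y').le _)
  -- the bond-sector letters at U, lowered to the common pair; (3.15) sizes at δr
  obtain ⟨hΔGb, hGbΔ⟩ := F.reg_ginv i α₀ U hM hα₀ hMa hU
  obtain ⟨g1, g2, g3, -⟩ := F.readG342 i α₀ U B₀ δ₀ hM hα₀ hMa hU hB₀ hδ₀ hT.2.2.1.1
  obtain ⟨k1, k2, k3, k4⟩ := F.kerG i α₀ U hM hα₀ hMa hU
  have g1' := hasMajorant_mono (g := toB6 (geo i) (F.Rr i) (F.Hp i)) (fun q : (κ × S i) × ι => F.blk i q.1.2) g1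
    (K' := fun a a' => max (F.cRG * B₀) F.BKG * (geo i).len a ^ 2 *
      Real.exp (-(min (min δ₀ δ₁) (min F.δcap F.δKG) * (geo i).dist a a')))
    fun (a a' : (geo i).Site) => prof_le (sq_nonneg ((geo i).len a)) hcle hBc.le hδr0 (F.dist_nonneg i a a')
  have g2' := fun k => hasMajorant_mono (g := toB6 (geo i) (F.Rr i) (F.Hp i)) (fun q : (κ × S i) × ι => F.blk i q.1.2) (g2 k)
    (K' := fun a a' => max (F.cRG * B₀) F.BKG * (geo i).len a *
      Real.exp (-(min (min δ₀ δ₁) (min F.δcap F.δKG) * (geo i).dist a a')))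
    fun (a a' : (geo i).Site) => prof_le (F.len_pos i a).le hcle hBc.le hδr0 (F.dist_nonneg i a a')
  have g3' := fun k => hasMajorant_mono (g := toB6 (geo i) (F.Rr i) (F.Hp i)) (fun q : (κ × S i) × ι => F.blk i q.1.2) (g3 k)
    (K' := fun a a' => max (F.cRG * B₀) F.BKG * (geo i).len a *
      Real.exp (-(min (min δ₀ δ₁) (min F.δcap F.δKG) * (geo i).dist a a')))
    fun (a a' : (geo i).Site) => prof_le (F.len_pos i a).le hcle hBc.le hδr0 (F.dist_nonneg i a a')
  have k1' := hasKernelBound_mono (g := toB6 (geo i) (F.Rr i) (F.Hp i)) (fun q : (κ × S i) × ι => F.blk i q.1.2) (F.vG_pos i) k1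
    (K' := fun a a' => max (F.cRG * B₀) F.BKG * (geo i).len a ^ 2 *
      Real.exp (-(min (min δ₀ δ₁) (min F.δcap F.δKG) * (geo i).dist a a')))
    fun (a a' : (geo i).Site) => prof_le (sq_nonneg ((geo i).len a)) hKle hBc.le hδrK (F.dist_nonneg i a a')
  have k2' := fun k => hasKernelBound_mono (g := toB6 (geo i) (F.Rr i) (F.Hp i)) (fun q : (κ × S i) × ι => F.blk i q.1.2)
    (F.vG_pos i) (k2 k)
    (K' := fun a a' => max (F.cRG * B₀) F.BKG * (geo i).len a *
      Real.exp (-(min (min δ₀ δ₁) (min F.δcap F.δKG) * (geo i).dist a a')))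
    fun (a a' : (geo i).Site) => prof_le (F.len_pos i a).le hKle hBc.le hδrK (F.dist_nonneg i a a')
  have k3' := fun l => hasKernelBound_mono (g := toB6 (geo i) (F.Rr i) (F.Hp i)) (fun q : (κ × S i) × ι => F.blk i q.1.2)
    (F.vG_pos i) (k3 l)
    (K' := fun a a' => max (F.cRG * B₀) F.BKG * (geo i).len a *
      Real.exp (-(min (min δ₀ δ₁) (min F.δcap F.δKG) * (geo i).dist a a')))
    fun (a a' : (geo i).Site) => prof_le (F.len_pos i a).le hKle hBc.le hδrK (F.dist_nonneg i a a')
  have k4' := fun k l => hasKernelBound_mono (g := toB6 (geo i) (F.Rr i) (F.Hp i)) (fun q : (κ × S i) × ι => F.blk i q.1.2)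
    (F.vG_pos i) (k4 k l)
    (K' := fun a a' => max (F.cRG * B₀) F.BKG * Real.exp (-(min (min δ₀ δ₁) (min F.δcap F.δKG) * (geo i).dist a a')))
    fun (a a' : (geo i).Site) => by
      have h := prof_le (p := 1) zero_le_one hKle hBc.le hδrK (F.dist_nonneg i a a')
      simpa only [mul_one] using h
  have hQb := F.hQb i U _ hδr hδrc
  have hQsb := F.hQsb i U _ hδr hδrc
  -- the class (3.37) read blockwise; the (3.57), (3.80)–(3.81) letters; (3.35) on plaquettes
  obtain ⟨hkF, hsF, h337B, h337F, h337Bτ, hA, hAτB⟩ := F.cplx i α₁ U U' hα₁ hU'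
  obtain ⟨h337B', h337FB, hAτF, hAFB, hAst, hAloc, hdAst⟩ := F.cplxG i α₁ U U' hα₁ hU'
  obtain ⟨hQm, hQsm⟩ := F.q_mul i α₁ U U' hα₁ hU'
  obtain ⟨hFc, hFcs⟩ := F.hF i α₁ U U' hα₁ hU'
  obtain ⟨hQbm, hQsbm⟩ := F.qb_mul i α₁ U U' hα₁ hU'
  obtain ⟨hF₂, hF₂s⟩ := F.hF₂ i α₁ U U' hα₁ hU' _ hδr hδrc
  have h35 := F.reg335 i α₀ U hM hα₀ hMa hU
  -- the G′ clause: the family's G′(U′U) is r06's extension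
  obtain ⟨hinv1, hinv2, -, -⟩ := H' (F.T i) (F.coord i U) (F.blk i) (F.kQ i U) (F.sQ i U) (F.cfun i) (F.w i U)
    (F.dist_nonneg i) (F.triangle i) (F.dist_self i) (F.dist_comm i) (F.len_pos i) (F.eta_le_len i) (F.eta_pos i)
    (fun α hα hα1 => F.h261 i _ α hδr hα hα1) (fun α hα => F.hST i _ α hδr hα) (F.unitary i U)
    (F.stencilB i) (F.stencilF i) (F.stencil0 i) (F.w_nonneg i U) (F.card_w i U) (F.hkQ i U) (F.hsQ i U) (F.hcfun i)
    hΔG hGΔ h1' h2' h3' α₁ hα₁.le ha1 (F.expA i U U') (F.kF i U U') (F.sF i U U')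
    hkF hsF h337B h337F h337Bτ hA hAτB
  have hGp := F.gop_eq i ((bg i).mul U' U) _ _ (F.mul_law i α₁ U U' hα₁ hU') hinv1 hinv2
  -- r06's input-Hölder clauses (v), (vi) for G
  obtain ⟨Tinv, GExt, hT1, hT2, hG1, hG2, hv, hvi⟩ := H (F.T i) (F.coord i U) (F.blk i) (F.kQ i U)
    (F.sQ i U) (F.cfun i) (F.w i U)
    (F.dist_nonneg i) (F.triangle i) (F.dist_self i) (F.dist_comm i) (F.len_pos i) (F.eta_le_len i) (F.eta_pos i)
    (F.L_one_le i) (fun α hα hα1 => F.h261 i _ α hδr hα hα1) (fun α hα => F.hST i _ α hδr hα) (F.T_comm i)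
    (F.unitary i U) h35 (F.stencilB i) (F.stencilF i) (F.stencilFB i) (F.stencilSt i) (F.stencilLoc i) (F.stencil0 i)
    (F.w_nonneg i U) (F.card_w i U) (F.hkQ i U) (F.hsQ i U) (F.hcfun i)
    h1' h2' h3' hΔG hGΔ (F.rep i) (F.hrep i) (F.hQc i U) (F.hQcs i U) (F.reg_cinv i α₀ U hM hα₀ hMa hU) hK'
    hQb hQsb (F.ha324 i) hΔGb hGbΔ g1' g2' g3' (F.vG_pos i) F.cKvG_pos k1' k2' k3' k4'
    α₁ hα₁.le ha2 (F.expA i U U') (F.kF i U U') (F.sF i U U')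
    hkF hsF h337B h337F h337B' h337Bτ h337FB hA hAτB hAτF hAFB hAst hAloc hdAst hQm hQsm hFc hFcs hQbm hQsbm rfl hF₂ hF₂s
  rw [← hGp] at hT1 hT2 hG1 hG2
  have hC := F.cop_eq i ((bg i).mul U' U) _ Tinv rfl hT1 hT2
  rw [← hC] at hG1 hG2
  have hinj : Function.Injective (F.rep i) := fun y₁ y₂ h => by
    have e := congrArg (fun p : S i × ι => F.blk i p.1) h
    simpa only [F.hrep] using e
  rw [rZero_add_pPrime_sections hinj, ← F.coord_mul i α₁ U U' hα₁ hU'] at hG1 hG2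
  have hGb := F.gb_eq i ((bg i).mul U' U) _ GExt rfl hG1 hG2
  rw [← hGb] at hv hvi
  exact F.e4h2G_transfer i α₀ U U' α₁ B₀ (max (F.cRG * B₀) F.BKG) B δ₀ (min (min δ₀ δ₁) (min F.δcap F.δKG)) Bβ Bε Bεβ
    hM hα₀ hMa hU hα₁ haW hU' hB₀ hcle hB hδr hδr0 hT.2.2.1.1 hT.2.2.2 hv hvi

/-- ★ **THE (3.44)-STEP OF SECT. B FOR G(U′U), INHABITED AT THE LETTERS GIVEN THE KERNEL-FORM LAW** (projection of
`stepE4H2GPos_of_e4h2GFrame`). [cite: Balaban1985BackgroundPropagators, Thm 3.4 p.400 + (3.44) p.398 + Thm 3.3 p.399 + p.407] -/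
theorem stepE4Pos_of_e4h2GFrame {GA : ∀ i, B9.KernelFamily (geo i) (bg i)} {Cinv : ∀ i, B9.SiteKernel (geo i) (bg i)}
    (F : E4H2GFrame c35 geo bg Gp b κ S GA Cinv) :
    B9SectBStepWhole.StepE4Pos F.dB c35 geo bg Gp GA Cinv GA :=
  StepPos.mono (fun c => c.1) (fun _ h => h.1) (fun _ _ _ _ _ h U' hU' => (h U' hU').1) (stepE4H2GPos_of_e4h2GFrame F)

/-- ★ **THE (3.45)-STEP OF SECT. B FOR G(U′U), INHABITED AT THE LETTERS GIVEN THE KERNEL-FORM LAW** (projection of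
`stepE4H2GPos_of_e4h2GFrame`). [cite: Balaban1985BackgroundPropagators, Thm 3.4 p.400 + (3.45) p.398 + Thm 3.3 p.399 + p.407] -/
theorem stepH2Pos_of_e4h2GFrame {GA : ∀ i, B9.KernelFamily (geo i) (bg i)} {Cinv : ∀ i, B9.SiteKernel (geo i) (bg i)}
    (F : E4H2GFrame c35 geo bg Gp b κ S GA Cinv) :
    B9SectBStepWhole.StepH2Pos F.dB c35 geo bg Gp GA Cinv GA :=
  StepPos.mono (fun c => c.2) (fun _ h => h.2) (fun _ _ _ _ _ h U' hU' => (h U' hU').2) (stepE4H2GPos_of_e4h2GFrame F)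

/-! ## The two-left-differences L² member (3.46)₄ of G(U′U) at the letters (member n = 3) — kernel-form input displayed

Same letters and law `kerG` as `L2GFrame`; in addition the (3.46)₄ member of `GA` AT U is READ as the L² block input `h346` of
r06's `B9Ineq346L2SecondDiffUniform.thm34_G_l2_second_uniform` (a genuine reading of the leaf's hypothesis
`L2Block (GA i) B₀ δ₀ U`, member n = 3) and r06's conclusion (viii) is WRITTEN back as the member n = 3 of the (3.46) block of `GA`
at U′U — the G-twin of `B9SectBGpStepAtLettersL2TwoDiff.L2TwoDiffFrame` (left half). -/

variable (c35 geo bg Gp b κ S) in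
/-- **THE LETTERS DICTIONARY FOR THE TWO-LEFT-DIFFERENCES L² MEMBER (3.46)₄ OF G** — `L2GFrame` plus the reading `read46_4G` (the
member n = 3 of `GA`'s (3.46) block at U ⇒ r06's L² block input `h346` for the letters `∇_k∇_mG(U)` on the bond carrier, constant
`cLG·B₀`, at any rate `δ′ ≦ δ`) and the writing `writeL2_4G` (r06's (viii) at 7δ/100 for the family's own G(U′U) ⇒ the member
n = 3 at U′U with (`wL4G B δ`, `wL4Gδ δ`)).  A hypothesis structure; nothing asserted.
[cite: Balaban1985BackgroundPropagators, (3.46) p.398 + Thm 3.3 p.399 + p.407; Balaban1984PropagatorsII, (2.52) p.232 + (2.64)–(2.66) p.234 + Lemma 2.1 p.234] -/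
structure L2SecondDiffGFrame (GA : ∀ i, B9.KernelFamily (geo i) (bg i)) (Cinv : ∀ i, B9.SiteKernel (geo i) (bg i))
    extends L2GFrame c35 geo bg Gp b κ S GA Cinv where
  cLG : ℝ
  cLG_nonneg : 0 ≤ cLG
  wL4G : ℝ → ℝ → ℝ
  wL4Gδ : ℝ → ℝ
  wL4G_pos : ∀ B δ : ℝ, 0 ≤ B → 0 < δ → 0 < wL4G B δ
  wL4Gδ_pos : ∀ δ : ℝ, 0 < δ → 0 < wL4Gδ δ
  /-- READING (3.46)₄ of `GA` at U (member n = 3) as the L² block input for the letters ∇_k∇_mG(U), at any rate δ′ ≦ δ. -/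
  read46_4G : ∀ i (α₀ : ℝ) (U : (bg i).Cfg) (B₀ δ δ' : ℝ), MInv ≤ (geo i).M → 0 < α₀ → (geo i).M * α₀ ≤ aInv →
    (bg i).Reg335 c35 α₀ U → 0 < B₀ → 0 < δ' → δ' ≤ δ → B9FromB6.L2Block (GA i) B₀ δ U →
    ∀ (k m : κ ⊕ κ) (y y'' : (geo i).Site) (hf ν : (κ × S i) × ι → ℝ) (Hh : ℝ), 0 ≤ Hh → (∀ x, |hf x| ≤ Hh) →
      (∀ x, blk i x.1.2 ≠ y → hf x = 0) → (∀ x, blk i x.1.2 ≠ y'' → ν x = 0) →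
      Real.sqrt (∑ x, (hf x * ((conj b (diffLetter (bT (T i)) (bU (coord i U)) ((((geo i).eta : ℂ))⁻¹) k)) *
          (conj b (diffLetter (bT (T i)) (bU (coord i U)) ((((geo i).eta : ℂ))⁻¹) m)) * Gb i U) ν x) ^ 2) ≤
        cLG * B₀ * Hh * Real.exp (-(δ' * (geo i).dist y y'')) * Real.sqrt (∑ x, ν x ^ 2)
  /-- WRITING (3.46)₄: r06's (viii) for the family's G(U′U) at (B, 7δ/100) ⇒ member n = 3 of `GA` at U′U. -/
  writeL2_4G : ∀ i (U U' : (bg i).Cfg) (α₁ B δ : ℝ), 0 < α₁ → α₁ ≤ aW → (bg i).Cplx337 α₁ U U' → 0 ≤ B → 0 < δ →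
    (∀ (k m : κ ⊕ κ) (y y' : (geo i).Site) (hf μ : (κ × S i) × ι → ℝ) (Hh : ℝ), 0 ≤ Hh → (∀ x, |hf x| ≤ Hh) →
      (∀ x, blk i x.1.2 ≠ y → hf x = 0) → (∀ x, blk i x.1.2 ≠ y' → μ x = 0) →
      Real.sqrt (∑ x, (hf x * ((conj b (diffLetter (bT (T i)) (bU (coord i U)) ((((geo i).eta : ℂ))⁻¹) k)) *
          (conj b (diffLetter (bT (T i)) (bU (coord i U)) ((((geo i).eta : ℂ))⁻¹) m)) * (Gb i ((bg i).mul U' U))) μ x) ^ 2) ≤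
        B * Hh * Real.exp (-(7 / 100 * δ * (geo i).dist y y')) * Real.sqrt (∑ x, μ x ^ 2)) →
    ∀ (lam : (geo i).Loc) (h : (geo i).Cut) (y y' : (geo i).Site), (geo i).cutIn h y → (geo i).suppIn lam y' →
      (GA i).l2 3 ((bg i).mul U' U) lam h ≤
        wL4G B δ * B9.pref6 ((geo i).len y) 3 * (geo i).cutSup h * Real.exp (-(wL4Gδ δ * (geo i).dist y y')) * (geo i).l2Norm lam

/-- ★ **THE (3.46)₄-STEP OF SECT. B FOR G(U′U) (member n = 3, two differences on the left), INHABITED AT THE LETTERS GIVEN THE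
KERNEL-FORM LAW**: every `L2SecondDiffGFrame` inhabits `B9SectBStepWhole.StepL2nPos F.dB c35 geo bg Gp GA Cinv GA 3`.  Proof: r06's
`B9Ineq346L2SecondDiffUniform.thm34_G_l2_second_uniform` at the common pair `(max(cRG·B₀, B_KG), δr)` with the (3.46)₄ input of
`GA` at U read by `read46_4G` (constant `cLG·B₀`), the three uniqueness identifications, then `writeL2_4G`.
[cite: Balaban1985BackgroundPropagators, Thm 3.4 p.400 + (3.46) p.398 + Thm 3.3 p.399 + (3.84)–(3.86) p.407; Balaban1984PropagatorsII, (2.52) p.232 + (2.64)–(2.66) p.234 + Lemma 2.1 p.234] -/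
theorem stepL2nPos_three_of_l2SecondDiffGFrame {GA : ∀ i, B9.KernelFamily (geo i) (bg i)} {Cinv : ∀ i, B9.SiteKernel (geo i) (bg i)}
    (F : L2SecondDiffGFrame c35 geo bg Gp b κ S GA Cinv) :
    B9SectBStepWhole.StepL2nPos F.dB c35 geo bg Gp GA Cinv GA 3 := by
  classical
  intro B₀ δ₀ Bβ Bε Bεβ B₁ δ₁ hB₀ hδ₀ hB₁ hδ₁
  -- the common rate and the common bond-sector constant of the call
  have hδr : 0 < min (min δ₀ δ₁) (min F.δcap F.δKG) := lt_min (lt_min hδ₀ hδ₁) (lt_min F.δcap_pos F.δKG_pos)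
  have hδr0 : min (min δ₀ δ₁) (min F.δcap F.δKG) ≤ δ₀ := le_trans (min_le_left _ _) (min_le_left _ _)
  have hδr1 : min (min δ₀ δ₁) (min F.δcap F.δKG) ≤ δ₁ := le_trans (min_le_left _ _) (min_le_right _ _)
  have hδrc : min (min δ₀ δ₁) (min F.δcap F.δKG) ≤ F.δcap := le_trans (min_le_right _ _) (min_le_left _ _)
  have hδrK : min (min δ₀ δ₁) (min F.δcap F.δKG) ≤ F.δKG := le_trans (min_le_right _ _) (min_le_right _ _)
  have hBG : 0 < F.cR * B₀ := mul_pos F.cR_pos hB₀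
  have hBb : 0 < F.cRG * B₀ := mul_pos F.cRG_pos hB₀
  have hBc : 0 < max (F.cRG * B₀) F.BKG := lt_max_of_lt_left hBb
  have hBK : 0 < F.cK * B₁ := mul_pos F.cK_pos hB₁
  have hcle : F.cRG * B₀ ≤ max (F.cRG * B₀) F.BKG := le_max_left _ _
  have hKle : F.BKG ≤ max (F.cRG * B₀) F.BKG := le_max_right _ _
  -- r06's uniform clauses: G′ (inverse identities of the extension) and the two-left-differences L² clause for G
  obtain ⟨a₁, ha₁, B', -, H'⟩ := thm34_Gp_uniform b κ F.dB (min (min δ₀ δ₁) (min F.δcap F.δKG)) (F.cR * B₀) F.Cq F.a₀ F.d₀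
    F.M₂ (F.Λf (min (min δ₀ δ₁) (min F.δcap F.δKG))) hBG F.Cq_nonneg F.a₀_nonneg F.M₂_nonneg hδr
    (fun α hα => F.Λf_one_le _ α hδr hα) F.hrepr
  have hB46 : 0 ≤ F.cLG * B₀ := mul_nonneg F.cLG_nonneg hB₀.le
  obtain ⟨a₂, ha₂, B, hB, H⟩ := B9Ineq346L2SecondDiffUniform.thm34_G_l2_second_uniform b κ F.dB
    (min (min δ₀ δ₁) (min F.δcap F.δKG)) (max (F.cRG * B₀) F.BKG)
    F.κQ (F.cR * B₀) (F.cK * B₁) F.cF F.Cq F.a₀ F.C₀ F.d₀ F.M₂ F.κQb F.cFb F.abar (F.Λf (min (min δ₀ δ₁) (min F.δcap F.δKG)))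
    (F.ΛvfG (min (min δ₀ δ₁) (min F.δcap F.δKG))) F.cvG (F.cLG * B₀) hBc.le F.κQ_pos hBG hBK F.cF_pos F.Cq_nonneg F.a₀_nonneg
    F.C₀_nonneg F.M₂_nonneg hδr F.κQb_nonneg F.cFb_nonneg F.abar_nonneg (fun α hα => F.Λf_one_le _ α hδr hα)
    (fun α hα => F.ΛvfG_one_le _ α hδr hα) F.cvG_nonneg hB46 F.hrepr
  refine ⟨F.MInv, min (min a₁ a₂) F.aW, F.aInv, (F.wL4G B (min (min δ₀ δ₁) (min F.δcap F.δKG)),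
    F.wL4Gδ (min (min δ₀ δ₁) (min F.δcap F.δKG))), F.MInv_pos, lt_min (lt_min ha₁ ha₂) F.aW_pos, F.aInv_pos,
    ⟨F.wL4G_pos B _ hB hδr, F.wL4Gδ_pos _ hδr⟩, ?_⟩
  intro i hM α₀ hα₀ hMa U hU hT α₁ hα₁ ha U' hU' lam h y y' hcut hs
  have ha1 : α₁ ≤ a₁ := le_trans ha (le_trans (min_le_left _ _) (min_le_left _ _))
  have ha2 : α₁ ≤ a₂ := le_trans ha (le_trans (min_le_left _ _) (min_le_right _ _))
  have haW : α₁ ≤ F.aW := le_trans ha (min_le_right _ _)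
  -- the site-sector letters at U
  obtain ⟨hΔG, hGΔ⟩ := F.reg_inv i α₀ U hM hα₀ hMa hU
  obtain ⟨h1, h2, h3, -⟩ := F.read342 i α₀ U B₀ δ₀ hM hα₀ hMa hU hB₀ hδ₀ hT.1.1.1
  have hc2 : ∀ a : (geo i).Site, 0 ≤ F.cR * B₀ * (geo i).len a ^ 2 := fun a => mul_nonneg hBG.le (sq_nonneg _)
  have hc1 : ∀ a : (geo i).Site, 0 ≤ F.cR * B₀ * (geo i).len a := fun a => mul_nonneg hBG.le (F.len_pos i a).le
  have h1' := hasMajorant_rate_le (g := toB6 (geo i) (F.Rr i) (F.Hp i)) (fun p : S i × ι => F.blk i p.1)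
    (fun a => (geo i).len a ^ 2) hc2 hδr0 (F.dist_nonneg i) h1
  have h2' := fun k => hasMajorant_rate_le (g := toB6 (geo i) (F.Rr i) (F.Hp i)) (fun p : S i × ι => F.blk i p.1)
    (fun a => (geo i).len a) hc1 hδr0 (F.dist_nonneg i) (h2 k)
  have h3' := fun k => hasMajorant_rate_le (g := toB6 (geo i) (F.Rr i) (F.Hp i)) (fun p : S i × ι => F.blk i p.1)
    (fun a => (geo i).len a) hc1 hδr0 (F.dist_nonneg i) (h3 k)
  -- the (3.48) kernel of C⁻¹(U) at δ₁ lowered to δr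
  have hK := F.readKer i α₀ U B₁ δ₁ hM hα₀ hMa hU hB₁ hδ₁ hT.2.1
  have hK' : ∀ y y' : (geo i).Site, |B9Thm34Inv.ker (B9Thm34Inv.vol (geo i) F.dB) (F.Cop i U) y y'| ≤
      F.cK * B₁ * (geo i).len y ^ (-(4 : ℝ)) * (geo i).len y' ^ (-(F.dB : ℝ)) *
        Real.exp (-(min (min δ₀ δ₁) (min F.δcap F.δKG) * (geo i).dist y y')) := by
    intro y y'
    refine (hK y y').trans (mul_le_mul_of_nonneg_left (Real.exp_le_exp.2 ?_) ?_)
    · nlinarith [F.dist_nonneg i y y', hδr1]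
    · exact mul_nonneg (mul_nonneg hBK.le (Real.rpow_nonneg (F.len_pos i y).le _))
        (Real.rpow_nonneg (F.len_pos i y').le _)
  -- the bond-sector letters at U: inverse identities; (3.42) of G read at (cRG·B₀, δ₀) and the kernel law at (B_KG, δ_KG), both
  -- lowered to the common pair (max(cRG·B₀, B_KG), δr); (3.15) sizes at δr
  obtain ⟨hΔGb, hGbΔ⟩ := F.reg_ginv i α₀ U hM hα₀ hMa hU
  obtain ⟨g1, g2, g3, -⟩ := F.readG342 i α₀ U B₀ δ₀ hM hα₀ hMa hU hB₀ hδ₀ hT.2.2.1.1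
  obtain ⟨k1, k2, k3, k4⟩ := F.kerG i α₀ U hM hα₀ hMa hU
  have g1' := hasMajorant_mono (g := toB6 (geo i) (F.Rr i) (F.Hp i)) (fun q : (κ × S i) × ι => F.blk i q.1.2) g1
    (K' := fun a a' => max (F.cRG * B₀) F.BKG * (geo i).len a ^ 2 *
      Real.exp (-(min (min δ₀ δ₁) (min F.δcap F.δKG) * (geo i).dist a a')))
    fun (a a' : (geo i).Site) => prof_le (sq_nonneg ((geo i).len a)) hcle hBc.le hδr0 (F.dist_nonneg i a a')
  have g2' := fun k => hasMajorant_mono (g := toB6 (geo i) (F.Rr i) (F.Hp i)) (fun q : (κ × S i) × ι => F.blk i q.1.2) (g2 k)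
    (K' := fun a a' => max (F.cRG * B₀) F.BKG * (geo i).len a *
      Real.exp (-(min (min δ₀ δ₁) (min F.δcap F.δKG) * (geo i).dist a a')))
    fun (a a' : (geo i).Site) => prof_le (F.len_pos i a).le hcle hBc.le hδr0 (F.dist_nonneg i a a')
  have g3' := fun k => hasMajorant_mono (g := toB6 (geo i) (F.Rr i) (F.Hp i)) (fun q : (κ × S i) × ι => F.blk i q.1.2) (g3 k)
    (K' := fun a a' => max (F.cRG * B₀) F.BKG * (geo i).len a *
      Real.exp (-(min (min δ₀ δ₁) (min F.δcap F.δKG) * (geo i).dist a a')))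
    fun (a a' : (geo i).Site) => prof_le (F.len_pos i a).le hcle hBc.le hδr0 (F.dist_nonneg i a a')
  have k1' := hasKernelBound_mono (g := toB6 (geo i) (F.Rr i) (F.Hp i)) (fun q : (κ × S i) × ι => F.blk i q.1.2) (F.vG_pos i) k1
    (K' := fun a a' => max (F.cRG * B₀) F.BKG * (geo i).len a ^ 2 *
      Real.exp (-(min (min δ₀ δ₁) (min F.δcap F.δKG) * (geo i).dist a a')))
    fun (a a' : (geo i).Site) => prof_le (sq_nonneg ((geo i).len a)) hKle hBc.le hδrK (F.dist_nonneg i a a')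
  have k2' := fun k => hasKernelBound_mono (g := toB6 (geo i) (F.Rr i) (F.Hp i)) (fun q : (κ × S i) × ι => F.blk i q.1.2)
    (F.vG_pos i) (k2 k)
    (K' := fun a a' => max (F.cRG * B₀) F.BKG * (geo i).len a *
      Real.exp (-(min (min δ₀ δ₁) (min F.δcap F.δKG) * (geo i).dist a a')))
    fun (a a' : (geo i).Site) => prof_le (F.len_pos i a).le hKle hBc.le hδrK (F.dist_nonneg i a a')
  have k3' := fun l => hasKernelBound_mono (g := toB6 (geo i) (F.Rr i) (F.Hp i)) (fun q : (κ × S i) × ι => F.blk i q.1.2)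
    (F.vG_pos i) (k3 l)
    (K' := fun a a' => max (F.cRG * B₀) F.BKG * (geo i).len a *
      Real.exp (-(min (min δ₀ δ₁) (min F.δcap F.δKG) * (geo i).dist a a')))
    fun (a a' : (geo i).Site) => prof_le (F.len_pos i a).le hKle hBc.le hδrK (F.dist_nonneg i a a')
  have k4' := fun k l => hasKernelBound_mono (g := toB6 (geo i) (F.Rr i) (F.Hp i)) (fun q : (κ × S i) × ι => F.blk i q.1.2)
    (F.vG_pos i) (k4 k l)
    (K' := fun a a' => max (F.cRG * B₀) F.BKG * Real.exp (-(min (min δ₀ δ₁) (min F.δcap F.δKG) * (geo i).dist a a')))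
    fun (a a' : (geo i).Site) => by
      have h := prof_le (p := 1) zero_le_one hKle hBc.le hδrK (F.dist_nonneg i a a')
      simpa only [mul_one] using h
  have hQb := F.hQb i U _ hδr hδrc
  have hQsb := F.hQsb i U _ hδr hδrc
  have h346 := F.read46_4G i α₀ U B₀ δ₀ _ hM hα₀ hMa hU hB₀ hδr hδr0 hT.2.2.1.2.1
  -- the class (3.37) read blockwise; the (3.57), (3.80)–(3.81) letters; (3.35) on plaquettes
  obtain ⟨hkF, hsF, h337B, h337F, h337Bτ, hA, hAτB⟩ := F.cplx i α₁ U U' hα₁ hU'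
  obtain ⟨h337B', h337FB, hAτF, hAFB, hAst, hAloc, hdAst⟩ := F.cplxG i α₁ U U' hα₁ hU'
  obtain ⟨hQm, hQsm⟩ := F.q_mul i α₁ U U' hα₁ hU'
  obtain ⟨hFc, hFcs⟩ := F.hF i α₁ U U' hα₁ hU'
  obtain ⟨hQbm, hQsbm⟩ := F.qb_mul i α₁ U U' hα₁ hU'
  obtain ⟨hF₂, hF₂s⟩ := F.hF₂ i α₁ U U' hα₁ hU' _ hδr hδrc
  have h35 := F.reg335 i α₀ U hM hα₀ hMa hU
  -- the G′ clause: the family's G′(U′U) is r06's extension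
  obtain ⟨hinv1, hinv2, -, -⟩ := H' (F.T i) (F.coord i U) (F.blk i) (F.kQ i U) (F.sQ i U) (F.cfun i) (F.w i U)
    (F.dist_nonneg i) (F.triangle i) (F.dist_self i) (F.dist_comm i) (F.len_pos i) (F.eta_le_len i) (F.eta_pos i)
    (fun α hα hα1 => F.h261 i _ α hδr hα hα1) (fun α hα => F.hST i _ α hδr hα) (F.unitary i U)
    (F.stencilB i) (F.stencilF i) (F.stencil0 i) (F.w_nonneg i U) (F.card_w i U) (F.hkQ i U) (F.hsQ i U) (F.hcfun i)
    hΔG hGΔ h1' h2' h3' α₁ hα₁.le ha1 (F.expA i U U') (F.kF i U U') (F.sF i U U')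
    hkF hsF h337B h337F h337Bτ hA hAτB
  have hGp := F.gop_eq i ((bg i).mul U' U) _ _ (F.mul_law i α₁ U U' hα₁ hU') hinv1 hinv2
  -- the (3.46)₄ clause for G
  obtain ⟨Tinv, GExt, hT1, hT2, hG1, hG2, hL2⟩ := H (F.T i) (F.coord i U) (F.blk i) (F.kQ i U) (F.sQ i U)
    (F.cfun i) (F.w i U)
    (F.dist_nonneg i) (F.triangle i) (F.dist_self i) (F.dist_comm i) (F.len_pos i) (F.eta_le_len i) (F.eta_pos i)
    (F.L_one_le i) (fun α hα hα1 => F.h261 i _ α hδr hα hα1) (fun α hα => F.hST i _ α hδr hα) (F.T_comm i)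
    (F.unitary i U) h35 (F.stencilB i) (F.stencilF i) (F.stencilFB i) (F.stencilSt i) (F.stencilLoc i) (F.stencil0 i)
    (F.w_nonneg i U) (F.card_w i U) (F.hkQ i U) (F.hsQ i U) (F.hcfun i)
    h1' h2' h3' hΔG hGΔ (F.rep i) (F.hrep i) (F.hQc i U) (F.hQcs i U) (F.reg_cinv i α₀ U hM hα₀ hMa hU) hK'
    hQb hQsb (F.ha324 i) hΔGb hGbΔ g1' g2' g3' (F.vG_pos i) F.cKvG_pos k1' k2' k3' k4' (F.hvolG i)
    (fun α hα => F.hSTvG i _ α hδr hα) h346 α₁ hα₁.le ha2 (F.expA i U U') (F.kF i U U') (F.sF i U U')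
    hkF hsF h337B h337F h337B' h337Bτ h337FB hA hAτB hAτF hAFB hAst hAloc hdAst hQm hQsm hFc hFcs hQbm hQsbm rfl hF₂ hF₂s
  -- the three identifications
  rw [← hGp] at hT1 hT2 hG1 hG2
  have hC := F.cop_eq i ((bg i).mul U' U) _ Tinv rfl hT1 hT2
  rw [← hC] at hG1 hG2
  have hinj : Function.Injective (F.rep i) := fun y₁ y₂ h => by
    have e := congrArg (fun p : S i × ι => F.blk i p.1) h
    simpa only [F.hrep] using e
  rw [rZero_add_pPrime_sections hinj, ← F.coord_mul i α₁ U U' hα₁ hU'] at hG1 hG2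
  have hGb := F.gb_eq i ((bg i).mul U' U) _ GExt rfl hG1 hG2
  rw [← hGb] at hL2
  exact F.writeL2_4G i U U' α₁ B (min (min δ₀ δ₁) (min F.δcap F.δKG)) hα₁ haW hU' hB hδr hL2 lam h y y' hcut hs


/-! ## The two-right-differences L² member (3.46)₆ of G(U′U) at the letters (member n = 5) — kernel-form inputs displayed

r06's `B9Ineq346L2RightDiffGUniform.thm34_G_l2_right_uniform` needs, beyond the (3.46)₄ inputs: Theorem 3.1's kernel form for
G′(U) on the site carrier IN THE BOND-SECTOR PAIRING (weights `vG`, constant `cKvG`) — a second named law `kerGp` —, (3.35) on the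
plaquettes adjacent to a bond in the second stencil shape (`reg335'`), and the COLUMN (ℓ¹ block) bounds of the letters Q, Q*, a,
F₂, F₂* (the transposes of their majorants; block-local averaging kernels have row AND column sums O(1)) — laws `hQbcol`,
`hQsbcol`, `hacol`, `hF₂col`; the (3.46)₆ member of `GA` at U is READ (`read46_6G`) and r06's (viii″) WRITTEN back (`writeL2_6G`).
The G-twin of `B9SectBGpStepAtLettersL2TwoDiff.L2TwoDiffFrame` (right half). -/

variable (c35 geo bg Gp b κ S) in
/-- **THE LETTERS DICTIONARY FOR THE TWO-RIGHT-DIFFERENCES L² MEMBER (3.46)₆ OF G** — `L2GFrame` plus: ★ the NAMED LAW `kerGp`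
(Theorem 3.1 (3.42)₁₋₄ for G′(U) in kernel form w.r.t. the bond-sector pairing weights `vG`, `cKvG`; constants `BKp, δKp`; N06
content as `kerG`), the second-stencil (3.35) law `reg335'`, the column-bound laws `hQbcol` ∕ `hQsbcol` (constant `κQcG`, every rate
≦ δcap), `hacol` (constant `abarcG`, every rate), `hF₂col` (constant `cFcG·α₁`, every rate ≦ δcap), the reading `read46_6G` (member
n = 5 of `GA`'s (3.46) block at U ⇒ r06's `h346` for the letters `G(U)∇_k∇_m`, constant `cLG6·B₀`) and the writing `writeL2_6G`
(r06's (viii″) at δ/50 ⇒ member n = 5 at U′U with (`wL6G B δ`, `wL6Gδ δ`)).  Field shapes = the hypotheses ∕ conclusion of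
`thm34_G_l2_right_uniform` verbatim.  A hypothesis structure; nothing asserted.
[cite: Balaban1985BackgroundPropagators, (3.46) p.398 + Thm 3.3 p.399 + (3.15)/(3.26) pp.393–394 + (3.35) p.396 + (3.80)–(3.81) p.407; Balaban1984PropagatorsII, (2.52) p.232 + (2.64)–(2.66) p.234 + Lemma 2.1 p.234] -/
structure L2RightDiffGFrame (GA : ∀ i, B9.KernelFamily (geo i) (bg i)) (Cinv : ∀ i, B9.SiteKernel (geo i) (bg i))
    extends L2GFrame c35 geo bg Gp b κ S GA Cinv where
  κQcG : ℝ
  abarcG : ℝ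
  cFcG : ℝ
  BKp : ℝ
  δKp : ℝ
  cLG6 : ℝ
  wL6G : ℝ → ℝ → ℝ
  wL6Gδ : ℝ → ℝ
  κQcG_nonneg : 0 ≤ κQcG
  abarcG_nonneg : 0 ≤ abarcG
  cFcG_nonneg : 0 ≤ cFcG
  BKp_pos : 0 < BKp
  δKp_pos : 0 < δKp
  cLG6_nonneg : 0 ≤ cLG6
  wL6G_pos : ∀ B δ : ℝ, 0 ≤ B → 0 < δ → 0 < wL6G B δ
  wL6Gδ_pos : ∀ δ : ℝ, 0 < δ → 0 < wL6Gδ δ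
  /-- ★ NAMED LAW (N06 content): Theorem 3.1 (3.42)₁₋₄ for G′(U) in kernel form, in the bond-sector pairing (weights `vG`, `cKvG`). -/
  kerGp : ∀ i (α₀ : ℝ) (U : (bg i).Cfg), MInv ≤ (geo i).M → 0 < α₀ → (geo i).M * α₀ ≤ aInv → (bg i).Reg335 c35 α₀ U →
    HasKernelBound (g := toB6 (geo i) (Rr i) (Hp i)) (fun p : S i × ι => blk i p.1) (vG i) cKvG (Gop i U)
        (fun a a' => BKp * (geo i).len a ^ 2 * Real.exp (-(δKp * (geo i).dist a a'))) ∧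
      (∀ k : κ ⊕ κ, HasKernelBound (g := toB6 (geo i) (Rr i) (Hp i)) (fun p : S i × ι => blk i p.1) (vG i) cKvG
        (conj b (diffLetter (T i) (coord i U) ((((geo i).eta : ℂ))⁻¹) k) * Gop i U)
        (fun a a' => BKp * (geo i).len a * Real.exp (-(δKp * (geo i).dist a a')))) ∧
      (∀ l : κ ⊕ κ, HasKernelBound (g := toB6 (geo i) (Rr i) (Hp i)) (fun p : S i × ι => blk i p.1) (vG i) cKvG
        (Gop i U * conj b (diffLetter (T i) (coord i U) ((((geo i).eta : ℂ))⁻¹) l))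
        (fun a a' => BKp * (geo i).len a * Real.exp (-(δKp * (geo i).dist a a')))) ∧
      (∀ k l : κ ⊕ κ, HasKernelBound (g := toB6 (geo i) (Rr i) (Hp i)) (fun p : S i × ι => blk i p.1) (vG i) cKvG
        (conj b (diffLetter (T i) (coord i U) ((((geo i).eta : ℂ))⁻¹) k) * Gop i U *
          conj b (diffLetter (T i) (coord i U) ((((geo i).eta : ℂ))⁻¹) l))
        (fun a a' => BKp * Real.exp (-(δKp * (geo i).dist a a'))))
  /-- (3.35) on the plaquettes adjacent to a bond, second stencil shape, at regular U above the thresholds. -/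
  reg335' : ∀ i (α₀ : ℝ) (U : (bg i).Cfg), MInv ≤ (geo i).M → 0 < α₀ → (geo i).M * α₀ ≤ aInv → (bg i).Reg335 c35 α₀ U →
    ∀ (m n : κ) (x : S i), ‖(plaqU (T i) (coord i U) m n ((T i n).symm x) : 𝔸) - 1‖ ≤
      C₀ * (((geo i).L ^ (geo i).scale (blk i x))⁻¹) ^ 2
  /-- COLUMN bounds of Q(V), Q*(V) (transposes of `hQb` ∕ `hQsb`) at every rate ≦ δcap. -/
  hQbcol : ∀ i (V : (bg i).Cfg) (δ : ℝ), 0 < δ → δ ≤ δcap → ∀ (x' : (κ × S i) × ι) (y'' : (geo i).Site),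
    (∑ z ∈ Finset.univ.filter (fun z : (κ × S i) × ι => blk i z.1.2 = y''), |Qb i V (Pi.single x' 1) z|) ≤
      κQcG * Real.exp (-(δ * (geo i).dist y'' (blk i x'.1.2)))
  hQsbcol : ∀ i (V : (bg i).Cfg) (δ : ℝ), 0 < δ → δ ≤ δcap → ∀ (x' : (κ × S i) × ι) (y'' : (geo i).Site),
    (∑ z ∈ Finset.univ.filter (fun z : (κ × S i) × ι => blk i z.1.2 = y''), |Qsb i V (Pi.single x' 1) z|) ≤
      κQcG * Real.exp (-(δ * (geo i).dist y'' (blk i x'.1.2)))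
  /-- COLUMN bound of the weight letter a (transpose of `ha324`; block-diagonal), at every rate. -/
  hacol : ∀ i (δ : ℝ), 0 < δ → ∀ (x' : (κ × S i) × ι) (y'' : (geo i).Site),
    (∑ z ∈ Finset.univ.filter (fun z : (κ × S i) × ι => blk i z.1.2 = y''), |ab i (Pi.single x' 1) z|) ≤
      abarcG * ((geo i).len y'' ^ 2)⁻¹ * Real.exp (-(δ * (geo i).dist y'' (blk i x'.1.2)))
  /-- COLUMN bounds of F₂(A), F₂*(A) (transposes of `hF₂`) at every rate ≦ δcap. -/
  hF₂col : ∀ i (α₁ : ℝ) (U U' : (bg i).Cfg), 0 < α₁ → (bg i).Cplx337 α₁ U U' → ∀ δ : ℝ, 0 < δ → δ ≤ δcap →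
    (∀ (x' : (κ × S i) × ι) (y'' : (geo i).Site),
      (∑ z ∈ Finset.univ.filter (fun z : (κ × S i) × ι => blk i z.1.2 = y''), |F₂ i U U' (Pi.single x' 1) z|) ≤
        cFcG * α₁ * Real.exp (-(δ * (geo i).dist y'' (blk i x'.1.2)))) ∧
    (∀ (x' : (κ × S i) × ι) (y'' : (geo i).Site),
      (∑ z ∈ Finset.univ.filter (fun z : (κ × S i) × ι => blk i z.1.2 = y''), |F₂s i U U' (Pi.single x' 1) z|) ≤
        cFcG * α₁ * Real.exp (-(δ * (geo i).dist y'' (blk i x'.1.2))))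
  /-- READING (3.46)₆ of `GA` at U (member n = 5) as the L² block input for the letters G(U)∇_k∇_m, at any rate δ′ ≦ δ. -/
  read46_6G : ∀ i (α₀ : ℝ) (U : (bg i).Cfg) (B₀ δ δ' : ℝ), MInv ≤ (geo i).M → 0 < α₀ → (geo i).M * α₀ ≤ aInv →
    (bg i).Reg335 c35 α₀ U → 0 < B₀ → 0 < δ' → δ' ≤ δ → B9FromB6.L2Block (GA i) B₀ δ U →
    ∀ (k m : κ ⊕ κ) (y y'' : (geo i).Site) (hf ν : (κ × S i) × ι → ℝ) (Hh : ℝ), 0 ≤ Hh → (∀ x, |hf x| ≤ Hh) →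
      (∀ x, blk i x.1.2 ≠ y → hf x = 0) → (∀ x, blk i x.1.2 ≠ y'' → ν x = 0) →
      Real.sqrt (∑ x, (hf x * (Gb i U * (conj b (diffLetter (bT (T i)) (bU (coord i U)) ((((geo i).eta : ℂ))⁻¹) k)) *
          (conj b (diffLetter (bT (T i)) (bU (coord i U)) ((((geo i).eta : ℂ))⁻¹) m))) ν x) ^ 2) ≤
        cLG6 * B₀ * Hh * Real.exp (-(δ' * (geo i).dist y y'')) * Real.sqrt (∑ x, ν x ^ 2)
  /-- WRITING (3.46)₆: r06's (viii″) for the family's G(U′U) at (B, δ/50) ⇒ member n = 5 of `GA` at U′U. -/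
  writeL2_6G : ∀ i (U U' : (bg i).Cfg) (α₁ B δ : ℝ), 0 < α₁ → α₁ ≤ aW → (bg i).Cplx337 α₁ U U' → 0 ≤ B → 0 < δ →
    (∀ (k m : κ ⊕ κ) (y y' : (geo i).Site) (hf μ : (κ × S i) × ι → ℝ) (Hh : ℝ), 0 ≤ Hh → (∀ x, |hf x| ≤ Hh) →
      (∀ x, blk i x.1.2 ≠ y → hf x = 0) → (∀ x, blk i x.1.2 ≠ y' → μ x = 0) →
      Real.sqrt (∑ x, (hf x * ((Gb i ((bg i).mul U' U)) *
          (conj b (diffLetter (bT (T i)) (bU (coord i U)) ((((geo i).eta : ℂ))⁻¹) k)) *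
          (conj b (diffLetter (bT (T i)) (bU (coord i U)) ((((geo i).eta : ℂ))⁻¹) m))) μ x) ^ 2) ≤
        B * Hh * Real.exp (-(1 / 50 * δ * (geo i).dist y y')) * Real.sqrt (∑ x, μ x ^ 2)) →
    ∀ (lam : (geo i).Loc) (h : (geo i).Cut) (y y' : (geo i).Site), (geo i).cutIn h y → (geo i).suppIn lam y' →
      (GA i).l2 5 ((bg i).mul U' U) lam h ≤
        wL6G B δ * B9.pref6 ((geo i).len y) 5 * (geo i).cutSup h * Real.exp (-(wL6Gδ δ * (geo i).dist y y')) * (geo i).l2Norm lam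

/-- ★ **THE (3.46)₆-STEP OF SECT. B FOR G(U′U) (member n = 5, two differences on the right), INHABITED AT THE LETTERS GIVEN THE
KERNEL-FORM LAWS**: every `L2RightDiffGFrame` inhabits `B9SectBStepWhole.StepL2nPos F.dB c35 geo bg Gp GA Cinv GA 5`.  Proof: r06's
`B9Ineq346L2RightDiffGUniform.thm34_G_l2_right_uniform` at the common pairs `(max(cR·B₀, B_Kp), δr)` (site sector),
`(max(cRG·B₀, B_KG), δr)` (bond sector), `δr = min(min(δ₀, δ₁), min(min(δcap, δKG), δKp))`, with the (3.46)₆ input of `GA` at U read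
by `read46_6G` (constant `cLG6·B₀`), the column laws, the three uniqueness identifications, then `writeL2_6G`.
[cite: Balaban1985BackgroundPropagators, Thm 3.4 p.400 + (3.46) p.398 + Thm 3.3 p.399 + (3.84)–(3.86) p.407; Balaban1984PropagatorsII, (2.52) p.232 + (2.64)–(2.66) p.234 + Lemma 2.1 p.234] -/
theorem stepL2nPos_five_of_l2RightDiffGFrame {GA : ∀ i, B9.KernelFamily (geo i) (bg i)} {Cinv : ∀ i, B9.SiteKernel (geo i) (bg i)}
    (F : L2RightDiffGFrame c35 geo bg Gp b κ S GA Cinv) :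
    B9SectBStepWhole.StepL2nPos F.dB c35 geo bg Gp GA Cinv GA 5 := by
  classical
  intro B₀ δ₀ Bβ Bε Bεβ B₁ δ₁ hB₀ hδ₀ hB₁ hδ₁
  -- the common rate and the common bond-sector constant of the call
  have hδr : 0 < min (min δ₀ δ₁) (min (min F.δcap F.δKG) F.δKp) :=
    lt_min (lt_min hδ₀ hδ₁) (lt_min (lt_min F.δcap_pos F.δKG_pos) F.δKp_pos)
  have hδr0 : min (min δ₀ δ₁) (min (min F.δcap F.δKG) F.δKp) ≤ δ₀ := le_trans (min_le_left _ _) (min_le_left _ _)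
  have hδr1 : min (min δ₀ δ₁) (min (min F.δcap F.δKG) F.δKp) ≤ δ₁ := le_trans (min_le_left _ _) (min_le_right _ _)
  have hδrc : min (min δ₀ δ₁) (min (min F.δcap F.δKG) F.δKp) ≤ F.δcap :=
    le_trans (min_le_right _ _) (le_trans (min_le_left _ _) (min_le_left _ _))
  have hδrK : min (min δ₀ δ₁) (min (min F.δcap F.δKG) F.δKp) ≤ F.δKG :=
    le_trans (min_le_right _ _) (le_trans (min_le_left _ _) (min_le_right _ _))
  have hδrp : min (min δ₀ δ₁) (min (min F.δcap F.δKG) F.δKp) ≤ F.δKp := le_trans (min_le_right _ _) (min_le_right _ _)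
  have hBG : 0 < F.cR * B₀ := mul_pos F.cR_pos hB₀
  have hBGc : 0 < max (F.cR * B₀) F.BKp := lt_max_of_lt_left hBG
  have hGle : F.cR * B₀ ≤ max (F.cR * B₀) F.BKp := le_max_left _ _
  have hGKle : F.BKp ≤ max (F.cR * B₀) F.BKp := le_max_right _ _
  have hBb : 0 < F.cRG * B₀ := mul_pos F.cRG_pos hB₀
  have hBc : 0 < max (F.cRG * B₀) F.BKG := lt_max_of_lt_left hBb
  have hBK : 0 < F.cK * B₁ := mul_pos F.cK_pos hB₁
  have hcle : F.cRG * B₀ ≤ max (F.cRG * B₀) F.BKG := le_max_left _ _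
  have hKle : F.BKG ≤ max (F.cRG * B₀) F.BKG := le_max_right _ _
  -- r06's uniform clauses: G′ (inverse identities of the extension) and the two-right-differences L² clause for G
  obtain ⟨a₁, ha₁, B', -, H'⟩ := thm34_Gp_uniform b κ F.dB (min (min δ₀ δ₁) (min (min F.δcap F.δKG) F.δKp)) (F.cR * B₀) F.Cq F.a₀ F.d₀
    F.M₂ (F.Λf (min (min δ₀ δ₁) (min (min F.δcap F.δKG) F.δKp))) hBG F.Cq_nonneg F.a₀_nonneg F.M₂_nonneg hδr
    (fun α hα => F.Λf_one_le _ α hδr hα) F.hrepr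
  have hB46 : 0 ≤ F.cLG6 * B₀ := mul_nonneg F.cLG6_nonneg hB₀.le
  obtain ⟨a₂, ha₂, B, hB, H⟩ := B9Ineq346L2RightDiffGUniform.thm34_G_l2_right_uniform b κ F.dB
    (min (min δ₀ δ₁) (min (min F.δcap F.δKG) F.δKp)) (max (F.cRG * B₀) F.BKG)
    F.κQ (max (F.cR * B₀) F.BKp) (F.cK * B₁) F.cF F.Cq F.a₀ F.C₀ F.d₀ F.M₂ F.κQb F.cFb F.abar F.κQcG F.abarcG F.cFcG
    (F.Λf (min (min δ₀ δ₁) (min (min F.δcap F.δKG) F.δKp)))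
    (F.ΛvfG (min (min δ₀ δ₁) (min (min F.δcap F.δKG) F.δKp))) F.cvG (F.cLG6 * B₀) hBc.le F.κQ_pos hBGc hBK F.cF_pos F.Cq_nonneg
    F.a₀_nonneg F.C₀_nonneg F.M₂_nonneg hδr F.κQb_nonneg F.cFb_nonneg F.abar_nonneg F.κQcG_nonneg F.abarcG_nonneg F.cFcG_nonneg
    (fun α hα => F.Λf_one_le _ α hδr hα) (fun α hα => F.ΛvfG_one_le _ α hδr hα) F.cvG_nonneg hB46 F.hrepr
  refine ⟨F.MInv, min (min a₁ a₂) F.aW, F.aInv, (F.wL6G B (min (min δ₀ δ₁) (min (min F.δcap F.δKG) F.δKp)),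
    F.wL6Gδ (min (min δ₀ δ₁) (min (min F.δcap F.δKG) F.δKp))), F.MInv_pos, lt_min (lt_min ha₁ ha₂) F.aW_pos, F.aInv_pos,
    ⟨F.wL6G_pos B _ hB hδr, F.wL6Gδ_pos _ hδr⟩, ?_⟩
  intro i hM α₀ hα₀ hMa U hU hT α₁ hα₁ ha U' hU' lam h y y' hcut hs
  have ha1 : α₁ ≤ a₁ := le_trans ha (le_trans (min_le_left _ _) (min_le_left _ _))
  have ha2 : α₁ ≤ a₂ := le_trans ha (le_trans (min_le_left _ _) (min_le_right _ _))
  have haW : α₁ ≤ F.aW := le_trans ha (min_le_right _ _)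
  -- the site-sector letters at U
  obtain ⟨hΔG, hGΔ⟩ := F.reg_inv i α₀ U hM hα₀ hMa hU
  obtain ⟨h1, h2, h3, -⟩ := F.read342 i α₀ U B₀ δ₀ hM hα₀ hMa hU hB₀ hδ₀ hT.1.1.1
  have hc2 : ∀ a : (geo i).Site, 0 ≤ F.cR * B₀ * (geo i).len a ^ 2 := fun a => mul_nonneg hBG.le (sq_nonneg _)
  have hc1 : ∀ a : (geo i).Site, 0 ≤ F.cR * B₀ * (geo i).len a := fun a => mul_nonneg hBG.le (F.len_pos i a).le
  have h1' := hasMajorant_rate_le (g := toB6 (geo i) (F.Rr i) (F.Hp i)) (fun p : S i × ι => F.blk i p.1)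
    (fun a => (geo i).len a ^ 2) hc2 hδr0 (F.dist_nonneg i) h1
  have h2' := fun k => hasMajorant_rate_le (g := toB6 (geo i) (F.Rr i) (F.Hp i)) (fun p : S i × ι => F.blk i p.1)
    (fun a => (geo i).len a) hc1 hδr0 (F.dist_nonneg i) (h2 k)
  have h3' := fun k => hasMajorant_rate_le (g := toB6 (geo i) (F.Rr i) (F.Hp i)) (fun p : S i × ι => F.blk i p.1)
    (fun a => (geo i).len a) hc1 hδr0 (F.dist_nonneg i) (h3 k)
  -- the same three majorants at the common site-sector constant max(cR·B₀, B_Kp), and the site-sector kernel law lowered to it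
  have h1c := hasMajorant_mono (g := toB6 (geo i) (F.Rr i) (F.Hp i)) (fun p : S i × ι => F.blk i p.1) h1'
    (K' := fun a a' => max (F.cR * B₀) F.BKp * (geo i).len a ^ 2 *
      Real.exp (-(min (min δ₀ δ₁) (min (min F.δcap F.δKG) F.δKp) * (geo i).dist a a')))
    fun (a a' : (geo i).Site) => prof_le (sq_nonneg ((geo i).len a)) hGle hBGc.le le_rfl (F.dist_nonneg i a a')
  have h2c := fun k => hasMajorant_mono (g := toB6 (geo i) (F.Rr i) (F.Hp i)) (fun p : S i × ι => F.blk i p.1) (h2' k)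
    (K' := fun a a' => max (F.cR * B₀) F.BKp * (geo i).len a *
      Real.exp (-(min (min δ₀ δ₁) (min (min F.δcap F.δKG) F.δKp) * (geo i).dist a a')))
    fun (a a' : (geo i).Site) => prof_le (F.len_pos i a).le hGle hBGc.le le_rfl (F.dist_nonneg i a a')
  have h3c := fun k => hasMajorant_mono (g := toB6 (geo i) (F.Rr i) (F.Hp i)) (fun p : S i × ι => F.blk i p.1) (h3' k)
    (K' := fun a a' => max (F.cR * B₀) F.BKp * (geo i).len a *
      Real.exp (-(min (min δ₀ δ₁) (min (min F.δcap F.δKG) F.δKp) * (geo i).dist a a')))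
    fun (a a' : (geo i).Site) => prof_le (F.len_pos i a).le hGle hBGc.le le_rfl (F.dist_nonneg i a a')
  obtain ⟨p1, p2, p3, p4⟩ := F.kerGp i α₀ U hM hα₀ hMa hU
  have p1' := hasKernelBound_mono (g := toB6 (geo i) (F.Rr i) (F.Hp i)) (fun p : S i × ι => F.blk i p.1) (F.vG_pos i) p1
    (K' := fun a a' => max (F.cR * B₀) F.BKp * (geo i).len a ^ 2 *
      Real.exp (-(min (min δ₀ δ₁) (min (min F.δcap F.δKG) F.δKp) * (geo i).dist a a')))
    fun (a a' : (geo i).Site) => prof_le (sq_nonneg ((geo i).len a)) hGKle hBGc.le hδrp (F.dist_nonneg i a a')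
  have p2' := fun k => hasKernelBound_mono (g := toB6 (geo i) (F.Rr i) (F.Hp i)) (fun p : S i × ι => F.blk i p.1)
    (F.vG_pos i) (p2 k)
    (K' := fun a a' => max (F.cR * B₀) F.BKp * (geo i).len a *
      Real.exp (-(min (min δ₀ δ₁) (min (min F.δcap F.δKG) F.δKp) * (geo i).dist a a')))
    fun (a a' : (geo i).Site) => prof_le (F.len_pos i a).le hGKle hBGc.le hδrp (F.dist_nonneg i a a')
  have p3' := fun l => hasKernelBound_mono (g := toB6 (geo i) (F.Rr i) (F.Hp i)) (fun p : S i × ι => F.blk i p.1)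
    (F.vG_pos i) (p3 l)
    (K' := fun a a' => max (F.cR * B₀) F.BKp * (geo i).len a *
      Real.exp (-(min (min δ₀ δ₁) (min (min F.δcap F.δKG) F.δKp) * (geo i).dist a a')))
    fun (a a' : (geo i).Site) => prof_le (F.len_pos i a).le hGKle hBGc.le hδrp (F.dist_nonneg i a a')
  have p4' := fun k l => hasKernelBound_mono (g := toB6 (geo i) (F.Rr i) (F.Hp i)) (fun p : S i × ι => F.blk i p.1)
    (F.vG_pos i) (p4 k l)
    (K' := fun a a' => max (F.cR * B₀) F.BKp *
      Real.exp (-(min (min δ₀ δ₁) (min (min F.δcap F.δKG) F.δKp) * (geo i).dist a a')))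
    fun (a a' : (geo i).Site) => by
      have h := prof_le (p := 1) zero_le_one hGKle hBGc.le hδrp (F.dist_nonneg i a a')
      simpa only [mul_one] using h
  -- the (3.48) kernel of C⁻¹(U) at δ₁ lowered to δr
  have hK := F.readKer i α₀ U B₁ δ₁ hM hα₀ hMa hU hB₁ hδ₁ hT.2.1
  have hK' : ∀ y y' : (geo i).Site, |B9Thm34Inv.ker (B9Thm34Inv.vol (geo i) F.dB) (F.Cop i U) y y'| ≤
      F.cK * B₁ * (geo i).len y ^ (-(4 : ℝ)) * (geo i).len y' ^ (-(F.dB : ℝ)) *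
        Real.exp (-(min (min δ₀ δ₁) (min (min F.δcap F.δKG) F.δKp) * (geo i).dist y y')) := by
    intro y y'
    refine (hK y y').trans (mul_le_mul_of_nonneg_left (Real.exp_le_exp.2 ?_) ?_)
    · nlinarith [F.dist_nonneg i y y', hδr1]
    · exact mul_nonneg (mul_nonneg hBK.le (Real.rpow_nonneg (F.len_pos i y).le _))
        (Real.rpow_nonneg (F.len_pos i y').le _)
  -- the bond-sector letters at U: inverse identities; (3.42) of G read at (cRG·B₀, δ₀) and the kernel law at (B_KG, δ_KG), both
  -- lowered to the common pair (max(cRG·B₀, B_KG), δr); (3.15) sizes at δr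
  obtain ⟨hΔGb, hGbΔ⟩ := F.reg_ginv i α₀ U hM hα₀ hMa hU
  obtain ⟨g1, g2, g3, -⟩ := F.readG342 i α₀ U B₀ δ₀ hM hα₀ hMa hU hB₀ hδ₀ hT.2.2.1.1
  obtain ⟨k1, k2, k3, k4⟩ := F.kerG i α₀ U hM hα₀ hMa hU
  have g1' := hasMajorant_mono (g := toB6 (geo i) (F.Rr i) (F.Hp i)) (fun q : (κ × S i) × ι => F.blk i q.1.2) g1
    (K' := fun a a' => max (F.cRG * B₀) F.BKG * (geo i).len a ^ 2 *
      Real.exp (-(min (min δ₀ δ₁) (min (min F.δcap F.δKG) F.δKp) * (geo i).dist a a')))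
    fun (a a' : (geo i).Site) => prof_le (sq_nonneg ((geo i).len a)) hcle hBc.le hδr0 (F.dist_nonneg i a a')
  have g2' := fun k => hasMajorant_mono (g := toB6 (geo i) (F.Rr i) (F.Hp i)) (fun q : (κ × S i) × ι => F.blk i q.1.2) (g2 k)
    (K' := fun a a' => max (F.cRG * B₀) F.BKG * (geo i).len a *
      Real.exp (-(min (min δ₀ δ₁) (min (min F.δcap F.δKG) F.δKp) * (geo i).dist a a')))
    fun (a a' : (geo i).Site) => prof_le (F.len_pos i a).le hcle hBc.le hδr0 (F.dist_nonneg i a a')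
  have g3' := fun k => hasMajorant_mono (g := toB6 (geo i) (F.Rr i) (F.Hp i)) (fun q : (κ × S i) × ι => F.blk i q.1.2) (g3 k)
    (K' := fun a a' => max (F.cRG * B₀) F.BKG * (geo i).len a *
      Real.exp (-(min (min δ₀ δ₁) (min (min F.δcap F.δKG) F.δKp) * (geo i).dist a a')))
    fun (a a' : (geo i).Site) => prof_le (F.len_pos i a).le hcle hBc.le hδr0 (F.dist_nonneg i a a')
  have k1' := hasKernelBound_mono (g := toB6 (geo i) (F.Rr i) (F.Hp i)) (fun q : (κ × S i) × ι => F.blk i q.1.2) (F.vG_pos i) k1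
    (K' := fun a a' => max (F.cRG * B₀) F.BKG * (geo i).len a ^ 2 *
      Real.exp (-(min (min δ₀ δ₁) (min (min F.δcap F.δKG) F.δKp) * (geo i).dist a a')))
    fun (a a' : (geo i).Site) => prof_le (sq_nonneg ((geo i).len a)) hKle hBc.le hδrK (F.dist_nonneg i a a')
  have k2' := fun k => hasKernelBound_mono (g := toB6 (geo i) (F.Rr i) (F.Hp i)) (fun q : (κ × S i) × ι => F.blk i q.1.2)
    (F.vG_pos i) (k2 k)
    (K' := fun a a' => max (F.cRG * B₀) F.BKG * (geo i).len a *
      Real.exp (-(min (min δ₀ δ₁) (min (min F.δcap F.δKG) F.δKp) * (geo i).dist a a')))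
    fun (a a' : (geo i).Site) => prof_le (F.len_pos i a).le hKle hBc.le hδrK (F.dist_nonneg i a a')
  have k3' := fun l => hasKernelBound_mono (g := toB6 (geo i) (F.Rr i) (F.Hp i)) (fun q : (κ × S i) × ι => F.blk i q.1.2)
    (F.vG_pos i) (k3 l)
    (K' := fun a a' => max (F.cRG * B₀) F.BKG * (geo i).len a *
      Real.exp (-(min (min δ₀ δ₁) (min (min F.δcap F.δKG) F.δKp) * (geo i).dist a a')))
    fun (a a' : (geo i).Site) => prof_le (F.len_pos i a).le hKle hBc.le hδrK (F.dist_nonneg i a a')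
  have k4' := fun k l => hasKernelBound_mono (g := toB6 (geo i) (F.Rr i) (F.Hp i)) (fun q : (κ × S i) × ι => F.blk i q.1.2)
    (F.vG_pos i) (k4 k l)
    (K' := fun a a' => max (F.cRG * B₀) F.BKG * Real.exp (-(min (min δ₀ δ₁) (min (min F.δcap F.δKG) F.δKp) * (geo i).dist a a')))
    fun (a a' : (geo i).Site) => by
      have h := prof_le (p := 1) zero_le_one hKle hBc.le hδrK (F.dist_nonneg i a a')
      simpa only [mul_one] using h
  have hQb := F.hQb i U _ hδr hδrc
  have hQsb := F.hQsb i U _ hδr hδrc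
  have h346 := F.read46_6G i α₀ U B₀ δ₀ _ hM hα₀ hMa hU hB₀ hδr hδr0 hT.2.2.1.2.1
  have hQcol := F.hQbcol i U _ hδr hδrc
  have hQscol := F.hQsbcol i U _ hδr hδrc
  have hacol := F.hacol i _ hδr
  -- the class (3.37) read blockwise; the (3.57), (3.80)–(3.81) letters; (3.35) on plaquettes
  obtain ⟨hkF, hsF, h337B, h337F, h337Bτ, hA, hAτB⟩ := F.cplx i α₁ U U' hα₁ hU'
  obtain ⟨h337B', h337FB, hAτF, hAFB, hAst, hAloc, hdAst⟩ := F.cplxG i α₁ U U' hα₁ hU'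
  obtain ⟨hQm, hQsm⟩ := F.q_mul i α₁ U U' hα₁ hU'
  obtain ⟨hFc, hFcs⟩ := F.hF i α₁ U U' hα₁ hU'
  obtain ⟨hQbm, hQsbm⟩ := F.qb_mul i α₁ U U' hα₁ hU'
  obtain ⟨hF₂, hF₂s⟩ := F.hF₂ i α₁ U U' hα₁ hU' _ hδr hδrc
  obtain ⟨hF₂c, hF₂sc⟩ := F.hF₂col i α₁ U U' hα₁ hU' _ hδr hδrc
  have h35 := F.reg335 i α₀ U hM hα₀ hMa hU
  have h35' := F.reg335' i α₀ U hM hα₀ hMa hU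
  -- the G′ clause: the family's G′(U′U) is r06's extension
  obtain ⟨hinv1, hinv2, -, -⟩ := H' (F.T i) (F.coord i U) (F.blk i) (F.kQ i U) (F.sQ i U) (F.cfun i) (F.w i U)
    (F.dist_nonneg i) (F.triangle i) (F.dist_self i) (F.dist_comm i) (F.len_pos i) (F.eta_le_len i) (F.eta_pos i)
    (fun α hα hα1 => F.h261 i _ α hδr hα hα1) (fun α hα => F.hST i _ α hδr hα) (F.unitary i U)
    (F.stencilB i) (F.stencilF i) (F.stencil0 i) (F.w_nonneg i U) (F.card_w i U) (F.hkQ i U) (F.hsQ i U) (F.hcfun i)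
    hΔG hGΔ h1' h2' h3' α₁ hα₁.le ha1 (F.expA i U U') (F.kF i U U') (F.sF i U U')
    hkF hsF h337B h337F h337Bτ hA hAτB
  have hGp := F.gop_eq i ((bg i).mul U' U) _ _ (F.mul_law i α₁ U U' hα₁ hU') hinv1 hinv2
  -- the (3.46)₆ clause for G
  obtain ⟨Tinv, GExt, hT1, hT2, hG1, hG2, hL2⟩ := H (F.T i) (F.coord i U) (F.blk i) (F.kQ i U) (F.sQ i U)
    (F.cfun i) (F.w i U)
    (F.dist_nonneg i) (F.triangle i) (F.dist_self i) (F.dist_comm i) (F.len_pos i) (F.eta_le_len i) (F.eta_pos i)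
    (F.L_one_le i) (fun α hα hα1 => F.h261 i _ α hδr hα hα1) (fun α hα => F.hST i _ α hδr hα) (F.T_comm i)
    (F.unitary i U) h35 h35' (F.stencilB i) (F.stencilF i) (F.stencilFB i) (F.stencilSt i) (F.stencilLoc i) (F.stencil0 i)
    (F.w_nonneg i U) (F.card_w i U) (F.hkQ i U) (F.hsQ i U) (F.hcfun i)
    h1c h2c h3c (F.vG_pos i) F.cKvG_pos p1' p2' p3' p4' hΔG hGΔ (F.rep i) (F.hrep i) (F.hQc i U) (F.hQcs i U)
    (F.reg_cinv i α₀ U hM hα₀ hMa hU) hK'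
    hQb hQsb (F.ha324 i) hQcol hQscol hacol hΔGb hGbΔ g1' g2' g3' k1' k2' k3' k4' (F.hvolG i)
    (fun α hα => F.hSTvG i _ α hδr hα) h346 α₁ hα₁.le ha2 (F.expA i U U') (F.kF i U U') (F.sF i U U')
    hkF hsF h337B h337F h337B' h337Bτ h337FB hA hAτB hAτF hAFB hAst hAloc hdAst hQm hQsm hFc hFcs hQbm hQsbm rfl hF₂ hF₂s
    hF₂c hF₂sc
  rw [← hGp] at hT1 hT2 hG1 hG2
  have hC := F.cop_eq i ((bg i).mul U' U) _ Tinv rfl hT1 hT2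
  rw [← hC] at hG1 hG2
  have hinj : Function.Injective (F.rep i) := fun y₁ y₂ h => by
    have e := congrArg (fun p : S i × ι => F.blk i p.1) h
    simpa only [F.hrep] using e
  rw [rZero_add_pPrime_sections hinj, ← F.coord_mul i α₁ U U' hα₁ hU'] at hG1 hG2
  have hGb := F.gb_eq i ((bg i).mul U' U) _ GExt rfl hG1 hG2
  rw [← hGb] at hL2
  exact F.writeL2_6G i U U' α₁ B (min (min δ₀ δ₁) (min (min F.δcap F.δKG) F.δKp)) hα₁ haW hU' hB hδr hL2 lam h y y' hcut hs


/-! ## The whole Sect.-B letters dictionary and row 13's `hB` in one instantiation -/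

variable (c35 geo bg Gp b κ S) in
/-- **THE WHOLE SECT.-B LETTERS DICTIONARY** — ALL the frames of the G′ side (`B9SectBGpStepAtLetters`: `CinvFrame`, `GlobFrame`,
`H1Frame`, `E4H2Frame`, `L2Frame` ⊂ `L2TwoDiffFrame`, `AnFrame`) and of the G side (`GFrame` ⊂ `KerGFrame` ⊂ `L2GFrame` ⊂
`L2RightDiffGFrame` ∕ `L2SecondDiffGFrame`, `GlobGFrame`, `H1GFrame`, `E4H2GFrame`, `AnGFrame`) on ONE set of letters (the shared
`GpFrame` ∕ `CinvFrame` ∕ `GFrame` ∕ `KerGFrame` ∕ `L2GFrame` ∕ `L2Frame` fields are merged by structure inheritance): the complete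
contract an operator-layer instance meets to discharge the Sect.-B obligation `hB : B9.SectBStepPrinted …` of the N06 record,
modulo Theorems 3.2 ∕ 3.3 (inputs of `sectBStepPrinted_of_sectBFrame`) and the displayed kernel-form laws `ker31` ∕ `kerG` ∕ `kerGp`
(ROW 13′).  A hypothesis structure; nothing asserted. [cite: Balaban1985BackgroundPropagators, Thm 3.4 p.400 + Sect. B pp.400–407] -/
structure SectBFrame (GA : ∀ i, B9.KernelFamily (geo i) (bg i)) (Cinv : ∀ i, B9.SiteKernel (geo i) (bg i))
    (IsAnalyticExt : ∀ i, B9.KernelFamily (geo i) (bg i) → (bg i).Cfg → ℝ → Prop)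
    extends L2RightDiffGFrame c35 geo bg Gp b κ S GA Cinv, L2SecondDiffGFrame c35 geo bg Gp b κ S GA Cinv,
      GlobGFrame c35 geo bg Gp b κ S GA Cinv, H1GFrame c35 geo bg Gp b κ S GA Cinv, E4H2GFrame c35 geo bg Gp b κ S GA Cinv,
      AnGFrame c35 geo bg Gp b κ S GA Cinv IsAnalyticExt,
      B9SectBGpStepAtLettersL2TwoDiff.L2TwoDiffFrame c35 geo bg Gp b κ S, B9SectBGpStepAtLetters.GlobFrame c35 geo bg Gp b κ S,
      B9SectBGpStepAtLetters.H1Frame c35 geo bg Gp b κ S, B9SectBGpStepAtLetters.E4H2Frame c35 geo bg Gp b κ S,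
      B9SectBGpStepAtLettersAn.AnFrame c35 geo bg Gp b κ S IsAnalyticExt

/-- The six L² members of G′(U′U) from the whole frame (n = 0,1,2,4 by `stepL2nPos_of_l2Frame`, n = 3, 5 by the two-difference
frame). [cite: Balaban1985BackgroundPropagators, (3.46) p.398 + Thm 3.4 p.400] -/
theorem stepL2nPos_gp_of_sectBFrame {GA : ∀ i, B9.KernelFamily (geo i) (bg i)} {Cinv : ∀ i, B9.SiteKernel (geo i) (bg i)}
    {IsAnalyticExt : ∀ i, B9.KernelFamily (geo i) (bg i) → (bg i).Cfg → ℝ → Prop}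
    (F : SectBFrame c35 geo bg Gp b κ S GA Cinv IsAnalyticExt) (n : Fin 6) :
    B9SectBStepWhole.StepL2nPos F.dB c35 geo bg Gp GA Cinv Gp n := by
  by_cases h3 : n = 3
  · subst h3; exact B9SectBGpStepAtLettersL2TwoDiff.stepL2nPos_three_of_l2TwoDiffFrame F.toL2TwoDiffFrame GA Cinv
  by_cases h5 : n = 5
  · subst h5; exact B9SectBGpStepAtLettersL2TwoDiff.stepL2nPos_five_of_l2TwoDiffFrame F.toL2TwoDiffFrame GA Cinv
  exact B9SectBGpStepAtLetters.stepL2nPos_of_l2Frame F.toL2TwoDiffFrame.toL2Frame GA Cinv n h3 h5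

/-- The six L² members of G(U′U) from the whole frame (n = 0,1,2,4 by `stepL2nPos_of_l2GFrame`, n = 3 by
`stepL2nPos_three_of_l2SecondDiffGFrame`, n = 5 by `stepL2nPos_five_of_l2RightDiffGFrame`).
[cite: Balaban1985BackgroundPropagators, (3.46) p.398 + Thm 3.3 p.399 + Thm 3.4 p.400] -/
theorem stepL2nPos_g_of_sectBFrame {GA : ∀ i, B9.KernelFamily (geo i) (bg i)} {Cinv : ∀ i, B9.SiteKernel (geo i) (bg i)}
    {IsAnalyticExt : ∀ i, B9.KernelFamily (geo i) (bg i) → (bg i).Cfg → ℝ → Prop}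
    (F : SectBFrame c35 geo bg Gp b κ S GA Cinv IsAnalyticExt) (n : Fin 6) :
    B9SectBStepWhole.StepL2nPos F.dB c35 geo bg Gp GA Cinv GA n := by
  by_cases h3 : n = 3
  · subst h3; exact stepL2nPos_three_of_l2SecondDiffGFrame F.toL2SecondDiffGFrame
  by_cases h5 : n = 5
  · subst h5; exact stepL2nPos_five_of_l2RightDiffGFrame F.toL2RightDiffGFrame
  exact stepL2nPos_of_l2GFrame F.toL2GFrame n h3 h5

/-- ★★ **ROW 13's `hB` IN ONE INSTANTIATION**: every whole Sect.-B letters dictionary `SectBFrame`, together with the model signs of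
the readings and Theorems 3.2 ∕ 3.3 of the leaf (`B9.Thm32Printed` at the frame's dimension `dB`, `B9.Thm33Printed`), yields the
Sect.-B obligation `B9.SectBStepPrinted F.dB c35 geo bg Gp GA Cinv IsAnalyticExt` of the N06 record — by
`B9SectBStepWhole.sectBStepPrinted_of_posBlockSteps` fed with the fourteen positive-input block-steps, each inhabited at the letters
by the frame theorems of `B9SectBGpStepAtLetters*` (G′ side, seat g2) and `B9SectBGStepAtLetters*` (G side).  Honest scope: the
three kernel-form laws `ker31` ∕ `kerG` ∕ `kerGp` inside the frame are N06 CONTENT (Theorems 3.1 ∕ 3.3 in the printed kernel form),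
displayed, not readings; the frame is NOT shown inhabited here; nothing of Sect. B is asserted beyond what r06's programme proves.
[cite: Balaban1985BackgroundPropagators, Thm 3.4 p.400 + Sect. B pp.400–407 + Thms 3.1–3.3 pp.397–399] -/
theorem sectBStepPrinted_of_sectBFrame {GA : ∀ i, B9.KernelFamily (geo i) (bg i)} {Cinv : ∀ i, B9.SiteKernel (geo i) (bg i)}
    {IsAnalyticExt : ∀ i, B9.KernelFamily (geo i) (bg i) → (bg i).Cfg → ℝ → Prop}
    (F : SectBFrame c35 geo bg Gp b κ S GA Cinv IsAnalyticExt)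
    {P : ∀ i, (geo i).Loc → Prop} (Sg : ∀ i, B9FromB6ModelSignsOn.ModelSignsOn (geo i) (P i))
    (h32 : B9.Thm32Printed F.dB c35 geo bg Cinv) (h33 : B9.Thm33Printed c35 geo bg Gp GA) :
    B9.SectBStepPrinted F.dB c35 geo bg Gp GA Cinv IsAnalyticExt :=
  B9SectBStepWhole.sectBStepPrinted_of_posBlockSteps Sg h32 h33
    (B9SectBStepWhole.stepAnalyticPos_of_halves
      (B9SectBGpStepAtLettersAn.stepAnalyticPos1_of_anFrame F.toAnFrame GA Cinv)
      (stepAnalyticPos1_of_anGFrame F.toAnGFrame))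
    (B9SectBGpStepAtLetters.stepEPos_of_gpFrame F.toGpFrame GA Cinv)
    (B9SectBStepWhole.stepL2Pos_of_members Sg (stepL2nPos_gp_of_sectBFrame F))
    (B9SectBGpStepAtLetters.stepGlobPos_of_globFrame F.toGlobFrame GA Cinv)
    (B9SectBGpStepAtLetters.stepH1Pos_of_h1Frame F.toH1Frame GA Cinv)
    (B9SectBGpStepAtLetters.stepE4Pos_of_e4h2Frame F.toE4H2Frame GA Cinv)
    (B9SectBGpStepAtLetters.stepH2Pos_of_e4h2Frame F.toE4H2Frame GA Cinv)
    (B9SectBGpStepAtLetters.stepKerPos_of_cinvFrame F.toCinvFrame GA)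
    (stepEPos_of_gFrame F.toGFrame)
    (B9SectBStepWhole.stepL2Pos_of_members Sg (stepL2nPos_g_of_sectBFrame F))
    (stepGlobPos_of_globGFrame F.toGlobGFrame) (stepH1Pos_of_h1GFrame F.toH1GFrame)
    (stepE4Pos_of_e4h2GFrame F.toE4H2GFrame) (stepH2Pos_of_e4h2GFrame F.toE4H2GFrame)

end Literature.MathematicalPhysics.QuantumFieldTheory.Balaban1983to89.B9SectBGStepAtLettersMore
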